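import Literature.Probability.RandomPlanarGeometry.LoewnerCurveLimitDomain
import Literature.Probability.RandomPlanarGeometry.DrivingCompactness
import Literature.Probability.RandomPlanarGeometry.DrivingProcessWeakLimit
import Literature.Probability.RandomPlanarGeometry.SimpleCurves
import HarnessLib

/-!
# Kemppainen–Smirnov's regular curves: the closed sets on which limits are Loewner curves

Topic `Literature/Probability/RandomPlanarGeometry` (family `crit-ising`). The deterministic
half of the proof of the main theorem of

* A. Kemppainen, S. Smirnov, *Random curves, scaling limits and Loewner evolutions*, Ann.
  Probab. 45 (2017) 698–779, §3.5 "Proof of the main theorem" with App. A, Lemmas A.5 and A.7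
  (arXiv:1212.6215: §3.5 p. 18, Lemmas 5.5 and 5.7),

in a fixed Dobrushin domain `(D; a, b)` with chordal uniformizing map `φ : ℍ → D`, in the shape
consumed by `DrivingProcessWeakLimit.lean` (KS Thm. 1.5 (ii)–(iii) "from the events": for every
`ε > 0` a CLOSED set `K` of curve classes, all describable through `φ`, on which the driving
path `c ↦ W(c) ∈ C([0, ∞), ℝ)` is continuous, with `μₙ Kᶜ ≤ ε` for all `n`).

KS §3.5: "Fix `ε > 0`. We will first choose four events `E_k` … `E₁` in such a way that the
half-plane capacity of `γ[0, t]` goes to infinity as `t → ∞` in a tight way … `E₂` the set of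
Hölder continuous simple curves … `E₃` the set of simple curves with Hölder continuous driving
process … `E₄` the set of simple curves that have function `ψ` as in Theorem 3.10 [continuity of
the hyperbolic geodesic to the tip] … Now the rest of the claims follow from Lemma A.5 of the
appendix." This file fixes the tree form of the event `E = ⋂ E_k` and PROVES "the rest of the
claims":

* `LoewnerRegularity` — the parameters of the events (transience radii and an index bound at
  `b` [KS Prop. 3.2 (i), the uniform transience index `N₀`], a capacity schedule [KS `E₁`], moduli of continuity of the
  driving function on each `[0, T]` [KS `E₃`, Thm. 3.9], and, for each localisation radius,
  a depth and a modulus of the approach of the hyperbolic geodesic to the tip [KS `E₄`,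
  Thm. 3.10]);
* `IsRegularCurve φ 𝔯 c`, `regularCurves φ 𝔯` — the simple chordal curves of `(D; a, b)`
  satisfying these bounds and the set of their classes (KS's `E ∩ X_simple(D, a, b)`);
* `Curve.exists_light_of_ne` — every non-constant curve class has a representative with no
  interval of constancy (the monotone–light factorisation of `SimpleCurves.lean`), the
  parametrisation in which KS's Lemma A.5 ("`γ` not constant on any subinterval") applies;
* `exists_capacity_parametrisation_of_limit_of_local_tipModulus`,
  `MarkedDomain.IsChordalUniformizing.exists_isLoewnerDescribed_of_limit_of_tipModulus` — KS's
  main lemma under their hypotheses (Lemmas A.5, A.7) with the tip modulus LOCALISED away from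
  `b` (the form delivered by KS Thm. 3.10, up to the hitting time of `B(b, ρ)`), in `ℍ` and in
  `D`;
* `MarkedDomain.IsChordalUniformizing.exists_capRad_of_driving_bound` — KS's event `E₁` (the
  driving bound `sup_{s ≤ M} |W s| ≤ β` of Prop. 3.8 (i)) implies the capacity clause
  `IsRegularCurve.le_capacity` (by Lawler's Lemma 4.13, `Loewner.hull_subset_closedBall_driving`);
* **`tendstoLocallyUniformly_drivingFunction_of_mem_regularCurves`** — if `xₙ ∈ regularCurves φ 𝔯`
  converge to `x`, then `x` is describable by the Loewner evolution through `φ` and the Loewner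
  transforms converge, `drivingFunction φ xₙ → drivingFunction φ x` locally uniformly (KS §3.5
  + Lemma A.7: equicontinuity and Arzelà–Ascoli for the driving terms, Lemma A.5 along
  subsequences, uniqueness of the driving function);
* **`isLoewnerDescribable_of_mem_closure_regularCurves`**,
  **`continuousOn_drivingPath_closure_regularCurves`** — every class in the CLOSURE of
  `regularCurves φ 𝔯` is describable, and the driving path is continuous there;
* **`ae_isLoewnerDescribable_and_tendstoInDistribution_of_regularCurves`** — plugged into
  `ae_isLoewnerDescribable_and_tendstoInDistribution_drivingPath`: if for every `ε > 0` some
  `regularCurves φ 𝔯` has `μₙ`-mass `≥ 1 - ε` for all `n` (the output of KS Prop. 3.2 /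
  Thms. 3.9–3.10, the probabilistic half, NOT in this file), then every weak limit `ν` of the
  `μₙ` is a.e. describable and the driving processes converge in law — the clauses (J′) of
  `LatticeModels/FKIsingCylinderIdentityAssembly.lean` and `InterfaceSLELimitData.lean`.

Faithfulness notes. (1) KS's `E₁` is "`P(sup_{[0, n]} |W_t| ≤ b_n) ≥ 1 - 1/n`" (Prop. 3.8),
used in the main lemma only to make the capacity of the limit curve tend to `∞` at `b`; here
the event records that consequence directly (`IsRegularCurve.le_capacity`: the curve is within
`capRad M` of `b` only after capacity time `M`), which avoids the exit-point estimate KS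
Lemma A.11 in the deterministic part. (2) KS's `E₂` (Hölder parametrisations of the curves) is
not needed for Lemma A.5 — the equicontinuity of a uniformly convergent sequence is automatic —
and is omitted; tightness is the business of the weak-limit hypothesis. (3) The transience clause
(`IsRegularCurve.transient`, KS Prop. 3.2 (i) verbatim: `N₀ ≤ N`, i.e. for `n > N` the curve does
not meet `∂B(b, ρ_{n-1})` after `∂B(b, ρ_n)`) is what makes limits reach `b` only at their end, as
the tree's `IsLoewnerDescribed` (compactified image of the trace) requires.
(4) The tip modulus is KS Thm. 3.10 with `y' = 0`, in the `ℍ`-metric, localised by the distance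
of the past curve to `b` (KS: `t ≤ τ_ρ`).

## References

* A. Kemppainen, S. Smirnov, Ann. Probab. 45 (2017) 698–779: §3.1 Prop. 3.2, §3.5, Thms. 3.9,
  3.10, App. A Lemmas A.5, A.7 (arXiv:1212.6215: Prop. 3.2, §3.5, Lemmas 5.5, 5.7).
  [KemppainenSmirnov2017]
* D. Chelkak, H. Duminil-Copin, C. Hongler, A. Kemppainen, S. Smirnov, C. R. Math. Acad. Sci.
  Paris 352 (2014) 157–161, Thm. 3. [CDHKSCRAS2014]
-/

noncomputable section

open Set Filter Metric Bornology Function MeasureTheory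
open _root_.Topology
open UpperHalfPlane (upperHalfPlaneSet isOpen_upperHalfPlaneSet)
open scoped NNReal ENNReal unitInterval BoundedContinuousFunction

namespace Literature.Probability.RandomPlanarGeometry

open scoped PathBorel

/-! ### Light representatives of curve classes -/

namespace Curve

variable {E : Type*} [MetricSpace E]

/-- **Monotone–light factorisation: every non-constant curve has a light representative.** If
`γ 0 ≠ γ 1`, there is a curve `γ₀` in the class of `γ` with NO interval of constancy (for
`s < t` some `u ∈ [s, t]` has `γ₀ u ≠ γ₀ s`), namely `γ = γ₀ ∘ φ` for the collapsing map
`φ = collapse γ` of `SimpleCurves.lean`; it has the same endpoints, and initial/final pairs of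
points of `γ₀` are initial/final pairs of points of `γ` (`γ₀ s' = γ s`, `γ₀ t' = γ t` with
`s ≤ t` whenever `s' ≤ t'`). (Whyburn's monotone–light factorisation for arcs; KS App. A,
Lemma A.7: "`γ` … not constant on any subinterval".) [folklore] -/
theorem exists_light_of_ne {γ : Curve E} (h01 : γ 0 ≠ γ 1) :
    ∃ γ₀ : Curve E, CurveClass.mk γ₀ = CurveClass.mk γ ∧ γ₀ 0 = γ 0 ∧ γ₀ 1 = γ 1 ∧
      (∀ s t : I, s < t → ∃ u, s ≤ u ∧ u ≤ t ∧ γ₀ u ≠ γ₀ s) ∧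
      ∀ s' t' : I, s' ≤ t' → ∃ s t : I, s ≤ t ∧ γ₀ s' = γ s ∧ γ₀ t' = γ t := by
  set φ := γ.collapse h01 with hφ
  have hsurj := γ.surjective_collapse h01
  set sec := Function.surjInv hsurj with hsec
  have hφsq : ∀ x, φ (sec x) = x := Function.surjInv_eq hsurj
  have hmono := γ.monotone_collapse h01
  -- `γ` is constant on the fibres of `φ`
  have hfib : ∀ a b, φ a = φ b → γ a = γ b := fun a b hab ↦
    γ.apply_eq_of_collapseFun_eq ((γ.collapse_eq_iff h01).1 hab)
  -- the candidate `γ₀ = γ ∘ sec`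
  set f : I → E := fun x ↦ γ (sec x) with hf
  have hfφ : ∀ t, f (φ t) = γ t := fun t ↦ hfib _ _ (hφsq (φ t))
  have hpre : ∀ C : Set E, f ⁻¹' C = φ '' (γ ⁻¹' C) := by
    intro C
    ext x
    constructor
    · intro hx
      exact ⟨sec x, hx, hφsq x⟩
    · rintro ⟨y, hy, rfl⟩
      show γ (sec (φ y)) ∈ C
      rwa [hfib _ _ (hφsq (φ y))]
  have hfc : Continuous f := by
    rw [continuous_iff_isClosed]
    intro C hC
    rw [hpre]
    exact ((hC.preimage γ.continuous).isCompact.image φ.continuous).isClosed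
  set γ₀ : Curve E := ⟨⟨f, hfc⟩⟩ with hγ₀
  have hγ₀f : ∀ x, γ₀ x = f x := fun x ↦ rfl
  have heq : γ₀.precomp φ = γ := by
    ext t
    exact hfφ t
  -- order of preimages
  have hsec_lt : ∀ x y : I, x < y → sec x < sec y := by
    intro x y hxy
    by_contra h
    have := hmono (not_lt.1 h)
    rw [hφsq, hφsq] at this
    exact absurd this (not_le.2 hxy)
  refine ⟨γ₀, ?_, ?_, ?_, ?_, ?_⟩
  · have h := dist_precomp_eq_zero γ₀ φ hmono (γ.collapse_zero h01) (γ.collapse_one h01)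
    rw [heq] at h
    rw [CurveClass.mk_eq_mk_iff_dist_eq_zero, dist_comm]
    exact h
  · show f 0 = γ 0
    refine hfib _ _ ?_
    rw [hφsq, γ.collapse_zero h01]
  · show f 1 = γ 1
    refine hfib _ _ ?_
    rw [hφsq, γ.collapse_one h01]
  · intro x y hxy
    by_contra hcon
    push Not at hcon
    have hlt : sec x < sec y := hsec_lt x y hxy
    have hconst : ∀ u, sec x ≤ u → u ≤ sec y → γ u = γ (sec x) := by
      intro u hxu huy
      have h1 : x ≤ φ u := by
        have := hmono hxu
        rwa [hφsq] at this
      have h2 : φ u ≤ y := by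
        have := hmono huy
        rwa [hφsq] at this
      have h3 := hcon (φ u) h1 h2
      rw [hγ₀f, hγ₀f, hfφ] at h3
      exact h3
    have h4 := (γ.collapse_eq_iff h01).2 ((γ.collapseFun_eq_iff hlt.le).2 hconst)
    rw [hφsq, hφsq] at h4
    exact absurd h4 (ne_of_lt hxy)
  · intro x y hxy
    rcases hxy.eq_or_lt with h | h
    · subst h
      exact ⟨sec x, sec x, le_rfl, rfl, rfl⟩
    · exact ⟨sec x, sec y, (hsec_lt x y h).le, rfl, rfl⟩

end Curve

/-! ### The main lemma in `ℍ` with a localised modulus of the tip approach -/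

/-- **Kemppainen–Smirnov's main lemma (Lemmas A.5, A.7) with the tip modulus localised.** The
variant of `exists_capacity_parametrisation_of_limit_of_tipModulus` (`LoewnerCurveLimit.lean`)
in which the uniform modulus of the tip approach `|f_{n, θ_n u}(W_n(θ_n u) + iy) - η_n(u)| ≤
ψ(y)`, `0 < y ≤ δ`, is only required on each parameter interval `[0, s']`, `s' < 1`, with `δ`
and `ψ` depending on `s'`, and only for all large `n` — the form in which KS Thm. 3.10 delivers
it (up to the hitting time of a neighbourhood of the target). The printed proof of Lemma A.5 is
local in the parameter, so the tree's core lemma `exists_capacity_parametrisation_of_limit_core`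
applies verbatim: if the limit capacity were constant on `[s, s']`, then by the equicontinuity
of Loewner chains and `W_n → W`, `η` would be constant on `[s, s']`.
[cite: KemppainenSmirnov2017, App. A Lemmas A.4, A.5, A.7] -/
theorem exists_capacity_parametrisation_of_limit_of_local_tipModulus
    {ηn : ℕ → ℝ → ℂ} {η : ℝ → ℂ} {θn : ℕ → ℝ → ℝ≥0} {γn : ℕ → ℝ≥0 → ℂ}
    {Wn : ℕ → ℝ≥0 → ℝ} {W : ℝ≥0 → ℝ}
    (hθc : ∀ n, ContinuousOn (θn n) (Ico 0 1)) (hθm : ∀ n, StrictMonoOn (θn n) (Ico 0 1))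
    (hθ0 : ∀ n, θn n 0 = 0) (hθinf : ∀ n, Tendsto (θn n) (𝓝[<] 1) atTop)
    (hγθ : ∀ n, ∀ u ∈ Ico (0 : ℝ) 1, γn n (θn n u) = ηn n u)
    (hWn : ∀ n, Continuous (Wn n)) (hgen : ∀ n, Loewner.IsGeneratedByCurve (Wn n) (γn n))
    (h0 : (η 0).im = 0) (hc : ContinuousOn η (Ico 0 1))
    (hlim : ∀ s, s < 1 → TendstoUniformlyOn ηn η atTop (Icc 0 s))
    (hnc : ∀ s s', 0 ≤ s → s < s' → s' < 1 → ∃ u ∈ Icc s s', η u ≠ η s)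
    (hψ : ∀ s' ∈ Ico (0 : ℝ) 1, ∃ δ : ℝ, 0 < δ ∧ ∃ ψ : ℝ → ℝ, Tendsto ψ (𝓝[>] 0) (𝓝 0) ∧
      ∀ᶠ n in atTop, ∀ u ∈ Icc (0 : ℝ) s', ∀ y ∈ Ioc (0 : ℝ) δ,
        ‖Loewner.loewnerInv (Wn n) (θn n u) (Wn n (θn n u) + y * Complex.I) - ηn n u‖ ≤ ψ y)
    (hdiv : ∀ M : ℝ, ∃ s ∈ Ico (0 : ℝ) 1,
      ∀ φ : ConformalEquiv (upperHalfPlaneSet \ hpFill (η '' Icc 0 s)) upperHalfPlaneSet,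
        IsHydrodynamicMap (hpFill (η '' Icc 0 s)) φ → M ≤ hcap (hpFill (η '' Icc 0 s)) φ)
    (hW : Continuous W) (hWlim : TendstoLocallyUniformly Wn W atTop) :
    ∃ (θ : ℝ → ℝ≥0) (γ : ℝ≥0 → ℂ), ContinuousOn θ (Ico 0 1) ∧ StrictMonoOn θ (Ico 0 1) ∧
      θ 0 = 0 ∧ Tendsto θ (𝓝[<] 1) atTop ∧ (∀ u ∈ Ico (0 : ℝ) 1, γ (θ u) = η u) ∧
      Continuous γ ∧ Loewner.IsGeneratedByCurve W γ ∧ TendstoLocallyUniformly γn γ atTop ∧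
      ∀ s ∈ Ico (0 : ℝ) 1,
        TendstoUniformlyOn (fun n u ↦ (θn n u : ℝ)) (fun u ↦ (θ u : ℝ)) atTop (Icc 0 s) := by
  refine exists_capacity_parametrisation_of_limit_core hθc hθm hθ0 hθinf hγθ hWn hgen h0 hc hlim
    (fun s s' hs hs' hss' φ φ' hφ hφ' ↦ ?_) hdiv hW hWlim
  have hIcc_sub : ∀ {s : ℝ}, s < 1 → Icc (0 : ℝ) s ⊆ Ico 0 1 := fun hs u hu ↦ ⟨hu.1, hu.2.trans_lt hs⟩
  refine (hcap_hpFill_image_Icc_mono hc hs hs' hss'.le hφ hφ').lt_of_ne fun heq ↦ ?_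
  -- the capacity, hence the clock increments, are constant on `[s, s']`
  have hVs := diff_hpFill (isCompact_Icc.image_of_continuousOn (hc.mono (hIcc_sub hs.2))).isClosed
    (isCompact_Icc.image_of_continuousOn (hc.mono (hIcc_sub hs.2))).isBounded (S := η '' Icc 0 s)
  have hts : Tendsto (fun n ↦ 2 * (θn n s : ℝ)) atTop (𝓝 (hcap (hpFill (η '' Icc 0 s)) φ)) :=
    tendsto_clock_of_tendstoUniformlyOn hθc hθm hθ0 hγθ hWn hgen hc hs (hlim s hs.2) hVs hφ
  have htu : ∀ u ∈ Icc s s', Tendsto (fun n ↦ 2 * (θn n u : ℝ)) atTop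
      (𝓝 (hcap (hpFill (η '' Icc 0 s)) φ)) := by
    intro u hu
    have huI : u ∈ Ico (0 : ℝ) 1 := ⟨hs.1.trans hu.1, hu.2.trans_lt hs'.2⟩
    obtain ⟨ψu, hψu, hVu⟩ := exists_isHydrodynamicMap_hpFill_image_Icc huI.1
      (hc.mono (hIcc_sub huI.2)) h0
    have h1 := hcap_hpFill_image_Icc_mono hc hs huI hu.1 hφ hψu
    have h2 := hcap_hpFill_image_Icc_mono hc huI hs' hu.2 hψu hφ'
    have hequ : hcap (hpFill (η '' Icc 0 u)) ψu = hcap (hpFill (η '' Icc 0 s)) φ :=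
      le_antisymm (h2.trans_eq heq.symm) h1
    rw [← hequ]
    exact tendsto_clock_of_tendstoUniformlyOn hθc hθm hθ0 hγθ hWn hgen hc huI (hlim u huI.2) hVu hψu
  -- the common limit time `θ̄` and the convergence of the driving values there
  set cbar : ℝ := hcap (hpFill (η '' Icc 0 s)) φ with hcbar
  have hθs : Tendsto (fun n ↦ (θn n s : ℝ)) atTop (𝓝 (cbar / 2)) := by
    have := hts.div_const 2
    simpa using this
  have hθu : ∀ u ∈ Icc s s', Tendsto (fun n ↦ (θn n u : ℝ)) atTop (𝓝 (cbar / 2)) := fun u hu ↦ by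
    have := (htu u hu).div_const 2
    simpa using this
  have hcbar0 : 0 ≤ cbar / 2 := by
    have := ge_of_tendsto' hθs fun n ↦ (θn n s).coe_nonneg
    linarith
  set tbar : ℝ≥0 := ⟨cbar / 2, hcbar0⟩ with htbar
  have hθs' : Tendsto (fun n ↦ θn n s) atTop (𝓝 tbar) := by
    rw [← NNReal.tendsto_coe]; exact hθs
  have hθu' : ∀ u ∈ Icc s s', Tendsto (fun n ↦ θn n u) atTop (𝓝 tbar) := fun u hu ↦ by
    rw [← NNReal.tendsto_coe]; exact hθu u hu
  have hWs : Tendsto (fun n ↦ Wn n (θn n s)) atTop (𝓝 (W tbar)) :=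
    hWlim.tendsto_comp (hW.continuousAt) hθs'
  have hWu : ∀ u ∈ Icc s s', Tendsto (fun n ↦ Wn n (θn n u)) atTop (𝓝 (W tbar)) := fun u hu ↦
    hWlim.tendsto_comp (hW.continuousAt) (hθu' u hu)
  -- the key estimate: for `y > 0`, `F_n(u, y) - F_n(s, y) → 0`
  have hkey : ∀ u ∈ Icc s s', ∀ y : ℝ, 0 < y →
      Tendsto (fun n ↦ Loewner.loewnerInv (Wn n) (θn n u) (Wn n (θn n u) + y * Complex.I) -
        Loewner.loewnerInv (Wn n) (θn n s) (Wn n (θn n s) + y * Complex.I)) atTop (𝓝 0) := by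
    intro u hu y hy
    have huI : u ∈ Ico (0 : ℝ) 1 := ⟨hs.1.trans hu.1, hu.2.trans_lt hs'.2⟩
    have hmono : ∀ n, θn n s ≤ θn n u := fun n ↦ (hθm n).monotoneOn hs huI hu.1
    set T : ℝ := cbar / 2 + 1 with hT
    set C : ℝ := 8 * ((y + 2 * T / y) / y) with hC
    have hC0 : 0 ≤ C := by positivity
    have hev1 : ∀ᶠ n in atTop, (θn n u : ℝ) ≤ T :=
      (hθu u hu).eventually (Iio_mem_nhds (by rw [hT]; linarith)) |>.mono fun n hn ↦ hn.le
    have hr : Tendsto (fun n ↦ (θn n u : ℝ) - θn n s) atTop (𝓝 0) := by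
      have := (hθu u hu).sub hθs
      simpa using this
    have hdW : Tendsto (fun n ↦ ((Wn n (θn n u) : ℂ) - Wn n (θn n s))) atTop (𝓝 0) := by
      have h1 := (Complex.continuous_ofReal.tendsto _).comp ((hWu u hu).sub hWs)
      simpa [Function.comp_def] using h1
    have hr2 : Tendsto (fun n ↦ 2 * ((θn n u : ℝ) - θn n s) / y) atTop (𝓝 0) := by
      have := (hr.const_mul 2).div_const y
      simpa using this
    have hev2 : ∀ᶠ n in atTop, 2 * ((θn n u : ℝ) - θn n s) / y ≤ y / 2 :=
      hr2.eventually_le_const (half_pos hy)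
    have hdWn : Tendsto (fun n ↦ ‖((Wn n (θn n u) : ℂ) - Wn n (θn n s))‖) atTop (𝓝 0) :=
      tendsto_zero_iff_norm_tendsto_zero.1 hdW
    have hev3 : ∀ᶠ n in atTop, ‖((Wn n (θn n u) : ℂ) - Wn n (θn n s))‖ ≤ y / 2 :=
      hdWn.eventually_le_const (half_pos hy)
    have hbound : ∀ᶠ n in atTop,
        ‖Loewner.loewnerInv (Wn n) (θn n u) (Wn n (θn n u) + y * Complex.I) -
            Loewner.loewnerInv (Wn n) (θn n s) (Wn n (θn n s) + y * Complex.I)‖ ≤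
          C * ‖((Wn n (θn n u) : ℂ) - Wn n (θn n s))‖ + C * (2 * ((θn n u : ℝ) - θn n s) / y) := by
      filter_upwards [hev1, hev2, hev3] with n h1 h2 h3
      set t : ℝ≥0 := θn n s with ht
      set t' : ℝ≥0 := θn n u with ht'
      set z : ℂ := (Wn n t : ℂ) + y * Complex.I with hzdef
      set z' : ℂ := (Wn n t' : ℂ) + y * Complex.I with hz'def
      have hz : z.im = y := by simp [hzdef]
      have hzz' : z' - z = (Wn n t' : ℂ) - Wn n t := by rw [hz'def, hzdef]; ring
      have htt' : t ≤ t' := hmono n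
      have htT : (t : ℝ) ≤ T := (NNReal.coe_le_coe.2 htt').trans h1
      have hA := Loewner.norm_loewnerInv_sub_le (hWn n) t' (z := z) (w := z')
        (by rw [hz]; exact hy) (by rw [hzz', hz]; exact h3)
      have hcoe : (((t' - t : ℝ≥0)) : ℝ) = (t' : ℝ) - t := NNReal.coe_sub htt'
      have hB := Loewner.norm_loewnerInv_add_sub_le (hWn n) t (t' - t) (z := z)
        (by rw [hz]; exact hy) (by rw [hcoe, hz]; exact h2)
      rw [add_tsub_cancel_of_le htt', hcoe, hz] at hB
      rw [hz] at hA
      have hKt' : 8 * ((y + 2 * (t' : ℝ) / y) / y) ≤ C := by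
        rw [hC]; gcongr
      have hKt : 8 * ((y + 2 * (t : ℝ) / y) / y) ≤ C := by
        rw [hC]; gcongr
      have hΔ : 0 ≤ 2 * ((t' : ℝ) - t) / y := by
        have : (t : ℝ) ≤ t' := NNReal.coe_le_coe.2 htt'
        positivity
      calc ‖Loewner.loewnerInv (Wn n) t' z' - Loewner.loewnerInv (Wn n) t z‖
          ≤ ‖Loewner.loewnerInv (Wn n) t' z' - Loewner.loewnerInv (Wn n) t' z‖ +
              ‖Loewner.loewnerInv (Wn n) t' z - Loewner.loewnerInv (Wn n) t z‖ :=
            norm_sub_le_norm_sub_add_norm_sub _ _ _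
        _ ≤ C * ‖z' - z‖ + C * (2 * ((t' : ℝ) - t) / y) :=
            add_le_add (hA.trans (mul_le_mul_of_nonneg_right hKt' (norm_nonneg _)))
              (hB.trans (mul_le_mul_of_nonneg_right hKt hΔ))
        _ = C * ‖((Wn n t' : ℂ) - Wn n t)‖ + C * (2 * ((t' : ℝ) - t) / y) := by rw [hzz']
    have hrhs : Tendsto (fun n ↦ C * ‖((Wn n (θn n u) : ℂ) - Wn n (θn n s))‖ +
        C * (2 * ((θn n u : ℝ) - θn n s) / y)) atTop (𝓝 0) := by
      have := (hdWn.const_mul C).add (hr2.const_mul C)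
      simpa using this
    exact squeeze_zero_norm' hbound hrhs
  -- the localised tip modulus on `[0, s']`
  obtain ⟨δ, hδ, ψ, hψ0, hψev⟩ := hψ s' hs'
  -- `‖η u - η s‖ ≤ 2 ψ y` for `u ∈ [s, s']` and `0 < y ≤ δ`
  have hchain : ∀ u ∈ Icc s s', ∀ y ∈ Ioc (0 : ℝ) δ, ‖η u - η s‖ ≤ 2 * ψ y := by
    intro u hu y hy
    have hu0 : u ∈ Icc (0 : ℝ) s' := ⟨hs.1.trans hu.1, hu.2⟩
    have hs0 : s ∈ Icc (0 : ℝ) s' := ⟨hs.1, hss'.le⟩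
    set Fu : ℕ → ℂ := fun n ↦
      Loewner.loewnerInv (Wn n) (θn n u) (Wn n (θn n u) + y * Complex.I) with hFu
    set Fs : ℕ → ℂ := fun n ↦
      Loewner.loewnerInv (Wn n) (θn n s) (Wn n (θn n s) + y * Complex.I) with hFs
    have hpt : ∀ᶠ n in atTop, ‖η u - η s‖ ≤
        ‖η u - ηn n u‖ + ‖Fu n - Fs n‖ + ‖ηn n s - η s‖ + 2 * ψ y := by
      filter_upwards [hψev] with n hn
      have a : ‖ηn n u - Fu n‖ ≤ ψ y := by rw [norm_sub_rev]; exact hn u hu0 y hy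
      have b : ‖Fs n - ηn n s‖ ≤ ψ y := hn s hs0 y hy
      have e : η u - η s = (η u - ηn n u) + (ηn n u - Fu n) + (Fu n - Fs n) + (Fs n - ηn n s) +
          (ηn n s - η s) := by ring
      calc ‖η u - η s‖ ≤ ‖η u - ηn n u‖ + ‖ηn n u - Fu n‖ + ‖Fu n - Fs n‖ + ‖Fs n - ηn n s‖ +
            ‖ηn n s - η s‖ := by
              rw [e]
              refine (norm_add_le _ _).trans (add_le_add ?_ le_rfl)
              refine (norm_add_le _ _).trans (add_le_add ?_ le_rfl)
              refine (norm_add_le _ _).trans (add_le_add ?_ le_rfl)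
              exact norm_add_le _ _
        _ ≤ ‖η u - ηn n u‖ + ‖Fu n - Fs n‖ + ‖ηn n s - η s‖ + 2 * ψ y := by linarith
    have l1 : Tendsto (fun n ↦ ‖η u - ηn n u‖) atTop (𝓝 0) := by
      have h := (hlim s' hs'.2).tendsto_at ⟨hs.1.trans hu.1, hu.2⟩
      have := tendsto_iff_norm_sub_tendsto_zero.1 h
      simpa [norm_sub_rev] using this
    have l2 : Tendsto (fun n ↦ ‖Fu n - Fs n‖) atTop (𝓝 0) :=
      tendsto_zero_iff_norm_tendsto_zero.1 (hkey u hu y hy.1)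
    have l3 : Tendsto (fun n ↦ ‖ηn n s - η s‖) atTop (𝓝 0) := by
      have h := (hlim s' hs'.2).tendsto_at ⟨hs.1, hss'.le⟩
      exact tendsto_iff_norm_sub_tendsto_zero.1 h
    have hl := ((l1.add l2).add l3).add_const (2 * ψ y)
    simp only [zero_add] at hl
    exact ge_of_tendsto hl hpt
  -- `ψ(y) → 0`: `η` is constant on `[s, s']`, contradicting the non-constancy
  obtain ⟨u, hu, hne⟩ := hnc s s' hs.1 hss' hs'.2
  have hzero : ‖η u - η s‖ ≤ 2 * 0 := by
    refine ge_of_tendsto (hψ0.const_mul 2) ?_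
    filter_upwards [Ioc_mem_nhdsGT hδ] with y hy using hchain u hu y hy
  rw [mul_zero, norm_le_zero_iff, sub_eq_zero] at hzero
  exact hne hzero


/-! ### The main lemma in a Dobrushin domain with a localised modulus of the tip approach -/

namespace MarkedDomain.IsChordalUniformizing

variable {D : DobrushinDomain} {φ : ConformalEquiv upperHalfPlaneSet D.carrier}

/-- **The half-plane data of a convergent sequence of simple chordal curves**, as
`exists_limit_pullback_data` (`LoewnerCurveLimitDomain.lean`), recording in addition that the
pull-backs `η_n` of the approximants reproduce them through the boundary extension
(`Φ ∘ η_n = c_n` on `[0, 1)`). [cite: KemppainenSmirnov2017, App. A Lemma A.4] -/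
theorem exists_limit_pullback_data' (hφ : D.IsChordalUniformizing φ)
    {cn : ℕ → Curve ℂ} {c : Curve ℂ}
    (h0n : ∀ n, cn n 0 = D.pt 0) (h1n : ∀ n, cn n 1 = D.pt 1)
    (hinn : ∀ n (s : I), 0 < (s : ℝ) → (s : ℝ) < 1 → cn n s ∈ D.carrier)
    (hinjn : ∀ n, InjOn (cn n) {s : I | 0 < (s : ℝ) ∧ (s : ℝ) < 1})
    (hinfn : ∀ n, Tendsto (fun u : ℝ ↦ (φ.symm (IccExtend zero_le_one (cn n) u)).im)
      (𝓝[<] 1) atTop)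
    (h0 : c 0 = D.pt 0)
    (hcl : ∀ s : I, (s : ℝ) < 1 → c s ∈ closure D.carrier ∧ c s ≠ D.pt 1)
    (hlim : TendstoUniformly (fun n (s : I) ↦ cn n s) c atTop) :
    ∃ (η : ℝ → ℂ) (ηn : ℕ → ℝ → ℂ) (θn : ℕ → ℝ → ℝ≥0),
      (∀ u ∈ Ico (0 : ℝ) 1, 0 ≤ (η u).im ∧ φ.boundaryExtension (η u) = IccExtend zero_le_one c u) ∧
      ContinuousOn η (Ico 0 1) ∧ (η 0).im = 0 ∧
      (∀ n, ∀ u ∈ Ico (0 : ℝ) 1, 0 ≤ (ηn n u).im ∧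
        φ.boundaryExtension (ηn n u) = IccExtend zero_le_one (cn n) u) ∧
      (∀ s, s < 1 → TendstoUniformlyOn ηn η atTop (Icc 0 s)) ∧
      (∀ n, ContinuousOn (θn n) (Ico 0 1)) ∧ (∀ n, StrictMonoOn (θn n) (Ico 0 1)) ∧
      (∀ n, θn n 0 = 0) ∧ (∀ n, Tendsto (θn n) (𝓝[<] 1) atTop) ∧
      (∀ n, ∀ u ∈ Ico (0 : ℝ) 1,
        Loewner.trace (drivingFunction φ (CurveClass.mk (cn n))) (θn n u) = ηn n u) ∧
      (∀ n, Continuous (drivingFunction φ (CurveClass.mk (cn n)))) ∧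
      (∀ n, Loewner.IsGeneratedByCurve (drivingFunction φ (CurveClass.mk (cn n)))
        (Loewner.trace (drivingFunction φ (CurveClass.mk (cn n))))) := by
  -- the inverse boundary correspondence `ψ` and the pull-backs
  obtain ⟨ψ, hψc, hψΦ, -, hψsymm, hψa⟩ := hφ.exists_inverse_boundaryExtension
  set ηn : ℕ → ℝ → ℂ := fun n u ↦ ψ (IccExtend zero_le_one (cn n) u) with hηn
  set η : ℝ → ℂ := fun u ↦ ψ (IccExtend zero_le_one c u) with hη
  have hext : ∀ (f : Curve ℂ) {u : ℝ} (hu : u ∈ Ico (0 : ℝ) 1),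
      IccExtend zero_le_one f u = f ⟨u, hu.1, hu.2.le⟩ := fun f u hu ↦
    IccExtend_of_mem zero_le_one f ⟨hu.1, hu.2.le⟩
  -- the limit
  have hcmem : ∀ {u : ℝ} (hu : u ∈ Ico (0 : ℝ) 1),
      IccExtend zero_le_one c u ∈ closure D.carrier \ {D.pt 1} := by
    intro u hu
    rw [hext c hu]
    exact ⟨(hcl _ hu.2).1, (hcl _ hu.2).2⟩
  have hηchar : ∀ u ∈ Ico (0 : ℝ) 1,
      0 ≤ (η u).im ∧ φ.boundaryExtension (η u) = IccExtend zero_le_one c u :=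
    fun u hu ↦ hψΦ _ (hcmem hu)
  have hηc : ContinuousOn η (Ico 0 1) :=
    hψc.comp (c.continuous.Icc_extend' (h := zero_le_one)).continuousOn fun u hu ↦ hcmem hu
  have hη0 : (η 0).im = 0 := by
    have h := hext c (u := 0) ⟨le_rfl, zero_lt_one⟩
    simp only [hη]
    rw [h]
    change (ψ (c 0)).im = 0
    rw [h0, hψa, Complex.zero_im]
  -- the approximants
  have hcnmem : ∀ n {u : ℝ} (hu : u ∈ Ico (0 : ℝ) 1),
      IccExtend zero_le_one (cn n) u ∈ closure D.carrier \ {D.pt 1} := by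
    intro n u hu
    rw [hext (cn n) hu]
    rcases hu.1.eq_or_lt with h00 | h00
    · have : (⟨u, hu.1, hu.2.le⟩ : I) = 0 := Subtype.ext h00.symm
      rw [this, h0n n]
      refine ⟨frontier_subset_closure (D.pt_mem_frontier 0), fun h ↦ ?_⟩
      rw [mem_singleton_iff] at h
      exact D.pt_injective.ne (by decide) h
    · exact ⟨subset_closure (hinn n _ h00 hu.2), fun h ↦ by
        rw [mem_singleton_iff] at h
        exact D.pt_notMem_carrier 1 (h ▸ hinn n _ h00 hu.2)⟩
  have hηnchar : ∀ n, ∀ u ∈ Ico (0 : ℝ) 1, 0 ≤ (ηn n u).im ∧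
      φ.boundaryExtension (ηn n u) = IccExtend zero_le_one (cn n) u := fun n u hu ↦
    hψΦ _ (hcnmem n hu)
  have hηn_eq : ∀ n, ∀ u (hu : u ∈ Ioo (0 : ℝ) 1),
      ηn n u = φ.symm (cn n ⟨u, hu.1.le, hu.2.le⟩) := by
    intro n u hu
    simp only [hηn]
    rw [hext (cn n) ⟨hu.1.le, hu.2⟩]
    exact hψsymm _ (hinn n _ hu.1 hu.2)
  have hηn0 : ∀ n, ηn n 0 = 0 := fun n ↦ by
    simp only [hηn]
    rw [hext (cn n) (u := 0) ⟨le_rfl, zero_lt_one⟩]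
    change ψ (cn n 0) = 0
    rw [h0n n, hψa]
  -- the capacity parametrisations of the approximants
  have hdata : ∀ n, ∃ (Wn : ℝ≥0 → ℝ) (θn : ℝ → ℝ≥0),
      IsLoewnerDescribed φ (CurveClass.mk (cn n)) Wn ∧ Wn 0 = 0 ∧
        ContinuousOn θn (Ico 0 1) ∧ StrictMonoOn θn (Ico 0 1) ∧ θn 0 = 0 ∧
        Tendsto θn (𝓝[<] 1) atTop ∧
        ∀ u (hu : u ∈ Ioo (0 : ℝ) 1),
          Loewner.trace Wn (θn u) = φ.symm (cn n ⟨u, hu.1.le, hu.2.le⟩) :=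
    fun n ↦ hφ.exists_isLoewnerDescribed_of_injOn (h0n n) (h1n n) (hinn n) (hinjn n) (hinfn n)
  choose Wn θn hdesc hWn0 hθc hθm hθ0 hθinf htrace using hdata
  have hWn_eq : ∀ n, drivingFunction φ (CurveClass.mk (cn n)) = Wn n := fun n ↦
    (hdesc n).drivingFunction_eq IsLoewnerDescribed.driving_unique_holds hφ
  have hgen : ∀ n, Loewner.IsGeneratedByCurve (Wn n) (Loewner.trace (Wn n)) := fun n ↦ by
    obtain ⟨-, γ, hγ, -⟩ := hdesc n
    exact Loewner.isGeneratedByCurve_trace ⟨γ, hγ⟩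
  have hγθ : ∀ n, ∀ u ∈ Ico (0 : ℝ) 1, Loewner.trace (Wn n) (θn n u) = ηn n u := by
    intro n u hu
    rcases hu.1.eq_or_lt with h00 | h00
    · rw [← h00, hθ0 n, Loewner.trace_zero, hWn0 n, hηn0 n, Complex.ofReal_zero]
    · rw [htrace n u ⟨h00, hu.2⟩, hηn_eq n u ⟨h00, hu.2⟩]
  -- uniform convergence of the pull-backs on `[0, s]`
  have hlimη : ∀ s, s < 1 → TendstoUniformlyOn ηn η atTop (Icc 0 s) := by
    intro s hs
    refine tendstoUniformlyOn_pullback hψc hlim (fun n t ↦ ?_) (fun t ↦ ?_) (s₀ := s) ?_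
    · rcases lt_or_ge (t : ℝ) 1 with ht | ht
      · have := hcnmem n (u := t) ⟨t.2.1, ht⟩
        rw [IccExtend_of_mem zero_le_one _ t.2] at this
        exact this.1
      · have : t = 1 := Subtype.ext (le_antisymm t.2.2 ht)
        rw [this, h1n n]
        exact frontier_subset_closure (D.pt_mem_frontier 1)
    · rcases lt_or_ge (t : ℝ) 1 with ht | ht
      · exact (hcl t ht).1
      · have : t = 1 := Subtype.ext (le_antisymm t.2.2 ht)
        rw [this]
        have h1 : c 1 = D.pt 1 := by
          have hl : Tendsto (fun n ↦ cn n 1) atTop (𝓝 (c 1)) := hlim.tendsto_at 1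
          simp only [h1n] at hl
          exact (tendsto_const_nhds_iff.1 hl).symm
        rw [h1]
        exact frontier_subset_closure (D.pt_mem_frontier 1)
    · intro t hts
      exact (hcl t (hts.trans_lt hs)).2
  refine ⟨η, ηn, θn, hηchar, hηc, hη0, hηnchar, hlimη, hθc, hθm, hθ0, hθinf, fun n u hu ↦ ?_,
    fun n ↦ ?_, fun n ↦ ?_⟩
  · rw [hWn_eq n]; exact hγθ n u hu
  · rw [hWn_eq n]; exact (hdesc n).continuous
  · rw [hWn_eq n]; exact hgen n

/-- **Kemppainen–Smirnov's main lemma in a Dobrushin domain, under their hypotheses (Lemmas A.5,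
A.7) with the tip modulus localised away from `b`.** Let `φ` be a chordal uniformizing map of
`(D; a, b)` with boundary extension `Φ`, and `c_n` simple chordal curves of `(D; a, b)` (from
`a` to `b`, interior in `D`, injective, entering `b` with `im φ⁻¹ → ∞`) converging uniformly, as
parametrised curves, to `c` with `c 0 = a`, `c 1 = b`, `c[0, 1) ⊆ closure D ∖ {b}` and `c` NOT
CONSTANT ON ANY SUBINTERVAL. Let `W_n = drivingFunction φ ⟦c_n⟧` be their Loewner transforms,
with traces `γ̂_n` and inverse chains `f_{n,t}`, and suppose: (tip modulus, KS Thm. 3.10 /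
Lemma A.7 (b)) for every `ρ > 0` there are `δ > 0` and `ψ` with `ψ(y) → 0` as `y ↓ 0` such that,
for all large `n` and all capacity times `t` at which the past `Φ(γ̂_n[0, t])` is at distance
`≥ ρ` from `b`, `|f_{n,t}(W_n(t) + iy) - γ̂_n(t)| ≤ ψ(y)` for `0 < y ≤ δ`; (capacity divergence,
KS's event `E₁`) for every `M` there is `r > 0` such that, for all large `n`, `Φ(γ̂_n(t))` is
within `r` of `b` only when `t ≥ M`; and `W_n → W` locally uniformly, `W` continuous. Then the
class of `c` is described through `φ` by `W` (`IsLoewnerDescribed φ ⟦c⟧ W`), `W 0 = 0`, and the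
capacity parametrisations converge (as in `exists_isLoewnerDescribed_of_limit`).
[cite: KemppainenSmirnov2017, App. A Lemmas A.4, A.5, A.7 and Thm. 3.10] [cite: CDHKSCRAS2014, Thm. 3] -/
theorem exists_isLoewnerDescribed_of_limit_of_tipModulus (hφ : D.IsChordalUniformizing φ)
    {cn : ℕ → Curve ℂ} {c : Curve ℂ} {W : ℝ≥0 → ℝ}
    (h0n : ∀ n, cn n 0 = D.pt 0) (h1n : ∀ n, cn n 1 = D.pt 1)
    (hinn : ∀ n (s : I), 0 < (s : ℝ) → (s : ℝ) < 1 → cn n s ∈ D.carrier)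
    (hinjn : ∀ n, InjOn (cn n) {s : I | 0 < (s : ℝ) ∧ (s : ℝ) < 1})
    (hinfn : ∀ n, Tendsto (fun u : ℝ ↦ (φ.symm (IccExtend zero_le_one (cn n) u)).im)
      (𝓝[<] 1) atTop)
    (h0 : c 0 = D.pt 0) (h1 : c 1 = D.pt 1)
    (hcl : ∀ s : I, (s : ℝ) < 1 → c s ∈ closure D.carrier ∧ c s ≠ D.pt 1)
    (hlim : TendstoUniformly (fun n (s : I) ↦ cn n s) c atTop)
    (hnc : ∀ s t : I, s < t → ∃ u, s ≤ u ∧ u ≤ t ∧ c u ≠ c s)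
    (htip : ∀ ρ : ℝ, 0 < ρ → ∃ δ : ℝ, 0 < δ ∧ ∃ ψ : ℝ → ℝ, Tendsto ψ (𝓝[>] 0) (𝓝 0) ∧
      ∀ᶠ n in atTop, ∀ t : ℝ≥0,
        (∀ t' ≤ t, ρ ≤ dist (φ.boundaryExtension
          (Loewner.trace (drivingFunction φ (CurveClass.mk (cn n))) t')) (D.pt 1)) →
        ∀ y ∈ Ioc (0 : ℝ) δ,
          ‖Loewner.loewnerInv (drivingFunction φ (CurveClass.mk (cn n))) t
              ((drivingFunction φ (CurveClass.mk (cn n)) t : ℂ) + y * Complex.I) -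
            Loewner.trace (drivingFunction φ (CurveClass.mk (cn n))) t‖ ≤ ψ y)
    (hcapdiv : ∀ M : ℝ, ∃ r : ℝ, 0 < r ∧ ∀ᶠ n in atTop, ∀ t : ℝ≥0,
      dist (φ.boundaryExtension (Loewner.trace (drivingFunction φ (CurveClass.mk (cn n))) t))
        (D.pt 1) < r → M ≤ t)
    (hW : Continuous W)
    (hWlim : TendstoLocallyUniformly (fun n ↦ drivingFunction φ (CurveClass.mk (cn n))) W atTop) :
    IsLoewnerDescribed φ (CurveClass.mk c) W ∧ W 0 = 0 ∧
      ∃ (θ : ℝ → ℝ≥0) (γ : ℝ≥0 → ℂ), ContinuousOn θ (Ico 0 1) ∧ StrictMonoOn θ (Ico 0 1) ∧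
        θ 0 = 0 ∧ Tendsto θ (𝓝[<] 1) atTop ∧ Continuous γ ∧ Loewner.IsGeneratedByCurve W γ ∧
        (∀ u (hu : u ∈ Ioo (0 : ℝ) 1), φ.boundaryExtension (γ (θ u)) = c ⟨u, hu.1.le, hu.2.le⟩) ∧
        TendstoLocallyUniformly (fun n ↦ Loewner.trace (drivingFunction φ (CurveClass.mk (cn n))))
          γ atTop := by
  obtain ⟨η, ηn, θn, hηchar, hηc, hη0, hηnchar, hlimη, hθc, hθm, hθ0, hθinf, hγθ, hWnc, hgen⟩ :=
    hφ.exists_limit_pullback_data' h0n h1n hinn hinjn hinfn h0 hcl hlim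
  have hext : ∀ (f : Curve ℂ) {u : ℝ} (hu : u ∈ Ico (0 : ℝ) 1),
      IccExtend zero_le_one f u = f ⟨u, hu.1, hu.2.le⟩ := fun f u hu ↦
    IccExtend_of_mem zero_le_one f ⟨hu.1, hu.2.le⟩
  have hunif : ∀ ε : ℝ, 0 < ε → ∀ᶠ n in atTop, ∀ t : I, dist (c t) (cn n t) < ε := fun ε hε ↦
    (Metric.tendstoUniformly_iff.1 hlim) ε hε
  /- (i) the pull-back of the limit is not constant on any subinterval -/
  have hnc' : ∀ s s', 0 ≤ s → s < s' → s' < 1 → ∃ u ∈ Icc s s', η u ≠ η s := by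
    intro s s' hs hss' hs'
    have hsI : s ∈ Ico (0 : ℝ) 1 := ⟨hs, hss'.trans hs'⟩
    have hs'I : s' ∈ Ico (0 : ℝ) 1 := ⟨hs.trans hss'.le, hs'⟩
    obtain ⟨u, hsu, hus', hne⟩ := hnc ⟨s, hsI.1, hsI.2.le⟩ ⟨s', hs'I.1, hs'I.2.le⟩
      (Subtype.mk_lt_mk.2 hss')
    have hsu' : s ≤ (u : ℝ) := Subtype.coe_le_coe.2 hsu
    have hus'' : (u : ℝ) ≤ s' := Subtype.coe_le_coe.2 hus'
    have huI : (u : ℝ) ∈ Ico (0 : ℝ) 1 := ⟨hs.trans hsu', hus''.trans_lt hs'⟩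
    refine ⟨u, ⟨hsu', hus''⟩, fun heq ↦ hne ?_⟩
    have h1 := (hηchar u huI).2
    have h2 := (hηchar s hsI).2
    rw [hext c huI] at h1
    rw [hext c hsI] at h2
    have h3 : c ⟨(u : ℝ), huI.1, huI.2.le⟩ = c ⟨s, hsI.1, hsI.2.le⟩ := by rw [← h1, ← h2, heq]
    exact h3
  /- (ii) the localised tip modulus along the clocks -/
  have hψ' : ∀ s' ∈ Ico (0 : ℝ) 1, ∃ δ : ℝ, 0 < δ ∧ ∃ ψ : ℝ → ℝ, Tendsto ψ (𝓝[>] 0) (𝓝 0) ∧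
      ∀ᶠ n in atTop, ∀ u ∈ Icc (0 : ℝ) s', ∀ y ∈ Ioc (0 : ℝ) δ,
        ‖Loewner.loewnerInv (drivingFunction φ (CurveClass.mk (cn n))) (θn n u)
            ((drivingFunction φ (CurveClass.mk (cn n)) (θn n u) : ℂ) + y * Complex.I) -
          ηn n u‖ ≤ ψ y := by
    intro s' hs'
    -- the distance `ρ₀ > 0` from `c[0, s']` to `b`
    set K : Set ℂ := c '' {s : I | (s : ℝ) ≤ s'} with hK
    have hKc : IsCompact K :=
      ((isClosed_le continuous_subtype_val continuous_const).isCompact).image c.continuous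
    have hKne : K.Nonempty := ⟨c 0, ⟨0, by simpa using hs'.1, rfl⟩⟩
    have hbK : D.pt 1 ∉ K := by
      rintro ⟨s, hs, hsb⟩
      exact (hcl s (hs.trans_lt hs'.2)).2 hsb
    set ρ₀ : ℝ := infDist (D.pt 1) K with hρ₀
    have hρ₀0 : 0 < ρ₀ := (hKc.isClosed.notMem_iff_infDist_pos hKne).1 hbK
    have hρK : ∀ p ∈ K, ρ₀ ≤ dist (D.pt 1) p := fun p hp ↦ infDist_le_dist_of_mem hp
    obtain ⟨δ, hδ, ψ, hψ0, hev⟩ := htip (ρ₀ / 2) (half_pos hρ₀0)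
    refine ⟨δ, hδ, ψ, hψ0, ?_⟩
    filter_upwards [hev, hunif (ρ₀ / 2) (half_pos hρ₀0)] with n hn hn' u hu y hy
    have huI : u ∈ Ico (0 : ℝ) 1 := ⟨hu.1, hu.2.trans_lt hs'.2⟩
    have key := hn (θn n u) ?_ y hy
    · rwa [hγθ n u huI] at key
    -- the past up to capacity `θ_n u` stays `≥ ρ₀ / 2` away from `b`
    intro t' ht'
    have himg := image_Icc_eq_of_clock (hθc n) (hθm n) (hθ0 n) huI
    have ht'mem : t' ∈ θn n '' Icc 0 u := by
      rw [himg]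
      exact ⟨bot_le, ht'⟩
    obtain ⟨v, hv, rfl⟩ := ht'mem
    have hvI : v ∈ Ico (0 : ℝ) 1 := ⟨hv.1, hv.2.trans_lt huI.2⟩
    rw [hγθ n v hvI, (hηnchar n v hvI).2, hext (cn n) hvI]
    have hvK : c ⟨v, hvI.1, hvI.2.le⟩ ∈ K := ⟨⟨v, hvI.1, hvI.2.le⟩, hv.2.trans hu.2, rfl⟩
    have e1 := hρK _ hvK
    have e2 := hn' ⟨v, hvI.1, hvI.2.le⟩
    have e3 := dist_triangle (D.pt 1) (cn n ⟨v, hvI.1, hvI.2.le⟩) (c ⟨v, hvI.1, hvI.2.le⟩)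
    rw [dist_comm (cn n _) (c _)] at e3
    rw [dist_comm]
    linarith
  /- (iii) the capacity of the limit pull-back diverges -/
  have hdiv' : ∀ M : ℝ, ∃ s ∈ Ico (0 : ℝ) 1,
      ∀ φ' : ConformalEquiv (upperHalfPlaneSet \ hpFill (η '' Icc 0 s)) upperHalfPlaneSet,
        IsHydrodynamicMap (hpFill (η '' Icc 0 s)) φ' → M ≤ hcap (hpFill (η '' Icc 0 s)) φ' := by
    intro M
    obtain ⟨r, hr, hev⟩ := hcapdiv (max M 0)
    -- a parameter `s < 1` at which `c` is within `r / 2` of `b`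
    have hg : Continuous fun u : ℝ ↦ dist (IccExtend zero_le_one c u) (D.pt 1) :=
      (c.continuous.Icc_extend' (h := zero_le_one)).dist continuous_const
    have hg1 : dist (IccExtend zero_le_one c 1) (D.pt 1) = 0 := by
      rw [IccExtend_of_mem zero_le_one c (right_mem_Icc.2 zero_le_one)]
      have : (⟨1, right_mem_Icc.2 zero_le_one⟩ : I) = 1 := rfl
      rw [this, h1, dist_self]
    have hev1 : ∀ᶠ u in 𝓝 (1 : ℝ), dist (IccExtend zero_le_one c u) (D.pt 1) < r / 2 := by
      have ht := hg.tendsto 1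
      rw [hg1] at ht
      exact ht (Iio_mem_nhds (half_pos hr))
    have hev2 : ∀ᶠ u in 𝓝[<] (1 : ℝ), u ∈ Ioo (0 : ℝ) 1 := Ioo_mem_nhdsLT one_pos
    obtain ⟨s, hs1, hs2⟩ := ((hev1.filter_mono nhdsWithin_le_nhds).and hev2).exists
    have hsI : s ∈ Ico (0 : ℝ) 1 := ⟨hs2.1.le, hs2.2⟩
    refine ⟨s, hsI, fun φ' hφ' ↦ ?_⟩
    have hθge : ∀ᶠ n in atTop, max M 0 ≤ (θn n s : ℝ) := by
      filter_upwards [hev, hunif (r / 2) (half_pos hr)] with n hn hn'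
      refine hn (θn n s) ?_
      rw [hγθ n s hsI, (hηnchar n s hsI).2, hext (cn n) hsI]
      rw [hext c hsI] at hs1
      have e2 := hn' ⟨s, hsI.1, hsI.2.le⟩
      calc dist (cn n ⟨s, hsI.1, hsI.2.le⟩) (D.pt 1)
          ≤ dist (cn n ⟨s, hsI.1, hsI.2.le⟩) (c ⟨s, hsI.1, hsI.2.le⟩) +
              dist (c ⟨s, hsI.1, hsI.2.le⟩) (D.pt 1) := dist_triangle _ _ _
        _ < r / 2 + r / 2 := by
            rw [dist_comm (cn n _) (c _)]
            exact add_lt_add e2 hs1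
        _ = r := by ring
    have hIcc_sub : Icc (0 : ℝ) s ⊆ Ico 0 1 := fun u hu ↦ ⟨hu.1, hu.2.trans_lt hsI.2⟩
    have hSc : IsCompact (η '' Icc 0 s) := isCompact_Icc.image_of_continuousOn (hηc.mono hIcc_sub)
    have hV := diff_hpFill hSc.isClosed hSc.isBounded (S := η '' Icc 0 s)
    have hcv := tendsto_clock_of_tendstoUniformlyOn hθc hθm hθ0 hγθ hWnc hgen hηc hsI
      (hlimη s hsI.2) hV hφ'
    have hmax : max M 0 ≤ hcap (hpFill (η '' Icc 0 s)) φ' := by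
      refine ge_of_tendsto hcv ?_
      filter_upwards [hθge] with n hn
      have : (0 : ℝ) ≤ θn n s := (θn n s).coe_nonneg
      linarith [le_max_right M 0]
    exact (le_max_left M 0).trans hmax
  /- (iv) the half-plane main lemma -/
  obtain ⟨θ, γ, hθcont, hθstrict, hθzero, hθdiv, hγθ', hγc, hgenW, hγlim, -⟩ :=
    exists_capacity_parametrisation_of_limit_of_local_tipModulus hθc hθm hθ0 hθinf hγθ hWnc hgen
      hη0 hηc hlimη hnc' hψ' hdiv' hW hWlim
  /- (v) packaging -/
  have hγ0 : γ 0 = 0 := by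
    have h := hγθ' 0 ⟨le_rfl, zero_lt_one⟩
    rw [hθzero] at h
    have hη00 : η 0 = 0 := by
      have hchar := hηchar 0 ⟨le_rfl, zero_lt_one⟩
      have hΦ := hchar.2
      rw [hext c ⟨le_rfl, zero_lt_one⟩] at hΦ
      change φ.boundaryExtension (η 0) = c 0 at hΦ
      rw [h0] at hΦ
      have ha : φ.boundaryExtension 0 = D.pt 0 :=
        φ.boundaryExtension_eq_of_hasBoundaryValue (mem_closure_upperHalfPlaneSet_iff.2 (by simp)) hφ.1
      exact JordanDomain.injOn_boundaryExtension φ (show (η 0) ∈ {z : ℂ | 0 ≤ z.im} from hchar.1)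
        (show (0 : ℂ) ∈ {z : ℂ | 0 ≤ z.im} by simp) (hΦ.trans ha.symm)
    rw [h, hη00]
  have hΦγ : ∀ u (hu : u ∈ Ioo (0 : ℝ) 1),
      φ.boundaryExtension (γ (θ u)) = c ⟨u, hu.1.le, hu.2.le⟩ := by
    intro u hu
    have huI : u ∈ Ico (0 : ℝ) 1 := ⟨hu.1.le, hu.2⟩
    rw [hγθ' u huI, (hηchar u huI).2, hext c huI]
  have hdescW : IsLoewnerDescribed φ (CurveClass.mk c) W :=
    hφ.isLoewnerDescribed_of_capacity_parametrisation' h0 h1 hθcont hθstrict hθzero hθdiv hW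
      hgenW hγ0 hΦγ
  have hW0 : W 0 = 0 := apply_zero_eq_zero_of_isGeneratedByCurve hgenW hγ0
  exact ⟨hdescW, hW0, θ, γ, hθcont, hθstrict, hθzero, hθdiv, hγc, hgenW, hΦγ, hγlim⟩

end MarkedDomain.IsChordalUniformizing


/-! ### Kemppainen–Smirnov's regularity data and regular curves -/

/-- **The parameters of Kemppainen–Smirnov's events `E = ⋂ E_k` (§3.5).** A transience scale at
the target (radii `transSeq n → 0` and an index bound `transIdx`: KS Prop. 3.2 (i), the uniform
transience index `N₀ = sup {n : γ meets ∂B(b, ρ_{n-1}) after ∂B(b, ρ_n)} ≤ N`), a capacity schedule (`capRad M`: the curve is within `capRad M` of `b` only after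
half-plane capacity time `M` — the consequence of KS's event `E₁` used in Lemma A.5), moduli of
continuity of the Loewner transform on the time intervals `[0, T]` (`drvMod T`: KS `E₃`,
Thm. 3.9) and, for each localisation radius `tipRad k ↓ 0`, a depth `tipDepth k` and a modulus
`tipMod k` of the approach of the hyperbolic geodesic to the tip (KS `E₄`, Thm. 3.10).
[cite: KemppainenSmirnov2017, §3.1 Prop. 3.2 and §3.5] -/
structure LoewnerRegularity where
  /-- The transience radii `ρ_n` at the target (positive, tending to `0`). -/
  transSeq : ℕ → ℝ
  transSeq_pos : ∀ n, 0 < transSeq n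
  tendsto_transSeq : Tendsto transSeq atTop (𝓝 0)
  /-- The bound `N` on the transience index: for `n > N`, once within `ρ_n` of `b` the curve
  stays within `ρ_{n-1}` of `b`. -/
  transIdx : ℕ
  /-- The capacity schedule: the curve is within `capRad M` of `b` only after capacity `M`. -/
  capRad : ℕ → ℝ
  capRad_pos : ∀ M, 0 < capRad M
  /-- Moduli of continuity of the Loewner transform on `[0, T]`. -/
  drvMod : ℕ → ℝ → ℝ
  tendsto_drvMod : ∀ T, Tendsto (drvMod T) (𝓝[>] 0) (𝓝 0)
  /-- Localisation radii of the tip modulus (accumulating at `0`). -/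
  tipRad : ℕ → ℝ
  tipRad_pos : ∀ k, 0 < tipRad k
  exists_tipRad_lt : ∀ ε : ℝ, 0 < ε → ∃ k, tipRad k < ε
  /-- Depths up to which the tip modulus applies. -/
  tipDepth : ℕ → ℝ
  tipDepth_pos : ∀ k, 0 < tipDepth k
  /-- Moduli of the approach of the hyperbolic geodesic to the tip. -/
  tipMod : ℕ → ℝ → ℝ
  tendsto_tipMod : ∀ k, Tendsto (tipMod k) (𝓝[>] 0) (𝓝 0)

variable {D : DobrushinDomain}

/-- **A regular simple chordal curve of `(D; a, b)` (a member of KS's event `E ∩ X_simple`).**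
`c : [0, 1] → ℂ` runs from `a` to `b`, with `c(0, 1) ⊆ D`, injectively, entering `b` with
diverging height of its pull-back (so that its class is described by the Loewner evolution through
`φ`, `SimpleCurveLoewner.lean`, with Loewner transform `W = drivingFunction φ ⟦c⟧`, trace `γ̂` and
inverse chain `f_t`), and, with `Φ` the boundary extension of `φ`:
(transience at `b`, KS Prop. 3.2 (i): `N₀ ≤ transIdx`) for `n > transIdx` and `s ≤ t`, if
`|c s - b| ≤ ρ_n` then `|c t - b| < ρ_{n-1}` ("`γ` does not intersect `∂B(b, ρ_{n-1})` after
intersecting `∂B(b, ρ_n)`");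
(capacity, KS `E₁`) `|Φ(γ̂ t) - b| < capRad M` only if `M ≤ t`;
(driving modulus, KS `E₃`) `|W s - W t| ≤ drvMod T |s - t|` for `s, t ≤ T`;
(tip modulus, KS `E₄` = Thm. 3.10 with `y' = 0`) if the past `Φ(γ̂[0, t])` is at distance
`≥ tipRad k` from `b`, then `|f_t(W t + iy) - γ̂ t| ≤ tipMod k y` for `0 < y ≤ tipDepth k`.
[cite: KemppainenSmirnov2017, §3.1 Prop. 3.2, §3.5, Thms. 3.9, 3.10] -/
structure IsRegularCurve (φ : ConformalEquiv upperHalfPlaneSet D.carrier) (𝔯 : LoewnerRegularity)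
    (c : Curve ℂ) : Prop where
  apply_zero : c 0 = D.pt 0
  apply_one : c 1 = D.pt 1
  mem_carrier : ∀ s : I, 0 < (s : ℝ) → (s : ℝ) < 1 → c s ∈ D.carrier
  injOn : InjOn c {s : I | 0 < (s : ℝ) ∧ (s : ℝ) < 1}
  tendsto_im : Tendsto (fun u : ℝ ↦ (φ.symm (IccExtend zero_le_one c u)).im) (𝓝[<] 1) atTop
  transient : ∀ n : ℕ, 𝔯.transIdx < n → ∀ s t : I, s ≤ t → dist (c s) (D.pt 1) ≤ 𝔯.transSeq n →
    dist (c t) (D.pt 1) < 𝔯.transSeq (n - 1)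
  le_capacity : ∀ (M : ℕ) (t : ℝ≥0),
    dist (φ.boundaryExtension (Loewner.trace (drivingFunction φ (CurveClass.mk c)) t)) (D.pt 1) <
      𝔯.capRad M → (M : ℝ) ≤ t
  driving_modulus : ∀ (T : ℕ) (s t : ℝ≥0), s ≤ (T : ℝ≥0) → t ≤ (T : ℝ≥0) →
    dist (drivingFunction φ (CurveClass.mk c) s) (drivingFunction φ (CurveClass.mk c) t) ≤
      𝔯.drvMod T (dist s t)
  tip_modulus : ∀ (k : ℕ) (t : ℝ≥0),
    (∀ t' ≤ t, 𝔯.tipRad k ≤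
      dist (φ.boundaryExtension (Loewner.trace (drivingFunction φ (CurveClass.mk c)) t'))
        (D.pt 1)) →
    ∀ y ∈ Ioc (0 : ℝ) (𝔯.tipDepth k),
      ‖Loewner.loewnerInv (drivingFunction φ (CurveClass.mk c)) t
          ((drivingFunction φ (CurveClass.mk c) t : ℂ) + y * Complex.I) -
        Loewner.trace (drivingFunction φ (CurveClass.mk c)) t‖ ≤ 𝔯.tipMod k y

/-- **Kemppainen–Smirnov's event `E ∩ X_simple(D, a, b)` as a set of curve classes**: the classes
of the regular simple chordal curves of `(D; a, b)` with parameters `𝔯`. Its closure is the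
closed set of KS's §3.5 on which limits are Loewner curves driven by the limits of the driving
terms (`isLoewnerDescribable_of_mem_closure_regularCurves`,
`continuousOn_drivingPath_closure_regularCurves`). [cite: KemppainenSmirnov2017, §3.5] -/
def regularCurves (φ : ConformalEquiv upperHalfPlaneSet D.carrier) (𝔯 : LoewnerRegularity) :
    Set (CurveClass ℂ) :=
  {x | ∃ c : Curve ℂ, CurveClass.mk c = x ∧ IsRegularCurve φ 𝔯 c}

variable {φ : ConformalEquiv upperHalfPlaneSet D.carrier} {𝔯 : LoewnerRegularity}

/-- Unfolding `regularCurves`. [folklore] -/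
theorem mem_regularCurves_iff {x : CurveClass ℂ} :
    x ∈ regularCurves φ 𝔯 ↔ ∃ c : Curve ℂ, CurveClass.mk c = x ∧ IsRegularCurve φ 𝔯 c :=
  Iff.rfl

namespace IsRegularCurve

variable {c : Curve ℂ}

/-- The class of a regular curve is a regular class. [folklore] -/
theorem mk_mem (h : IsRegularCurve φ 𝔯 c) : CurveClass.mk c ∈ regularCurves φ 𝔯 :=
  ⟨c, rfl, h⟩

/-- A regular curve runs in `closure D`. [folklore] -/
theorem mem_closure (h : IsRegularCurve φ 𝔯 c) (s : I) : c s ∈ closure D.carrier := by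
  rcases lt_or_ge (s : ℝ) 1 with hs1 | hs1
  · rcases (unitInterval.nonneg s).eq_or_lt with hs0 | hs0
    · have : s = 0 := Subtype.ext hs0.symm
      rw [this, h.apply_zero]
      exact frontier_subset_closure (D.pt_mem_frontier 0)
    · exact subset_closure (h.mem_carrier s hs0 hs1)
  · have : s = 1 := Subtype.ext (le_antisymm s.2.2 hs1)
    rw [this, h.apply_one]
    exact frontier_subset_closure (D.pt_mem_frontier 1)

/-- The class of a regular curve is described by the Loewner evolution through `φ`.
[cite: Lawler2005, §4.1 Prop. 4.4] -/
theorem isLoewnerDescribable_mk (hφ : D.IsChordalUniformizing φ) (h : IsRegularCurve φ 𝔯 c) :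
    IsLoewnerDescribable φ (CurveClass.mk c) :=
  hφ.isLoewnerDescribable_mk_of_injOn h.apply_zero h.apply_one h.mem_carrier h.injOn h.tendsto_im

/-- The Loewner transform of a regular curve starts at `0`. [cite: Lawler2005, §4.1 p. 96] -/
theorem drivingFunction_zero (hφ : D.IsChordalUniformizing φ) (h : IsRegularCurve φ 𝔯 c) :
    drivingFunction φ (CurveClass.mk c) 0 = 0 :=
  hφ.drivingFunction_mk_apply_zero_of_injOn h.apply_zero h.apply_one h.mem_carrier h.injOn
    h.tendsto_im

/-- **Regularity is invariant under increasing reparametrisation** (all clauses concern the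
class, the order of the parameters, or the trace). [folklore] -/
theorem reparam (h : IsRegularCurve φ 𝔯 c) (ρ : I ≃o I) : IsRegularCurve φ 𝔯 (c.reparam ρ) := by
  have hρ0 : ρ 0 = 0 := ρ.map_bot
  have hρ1 : ρ 1 = 1 := ρ.map_top
  have hρmem : ∀ s : I, 0 < (s : ℝ) → (s : ℝ) < 1 →
      0 < ((ρ s : I) : ℝ) ∧ ((ρ s : I) : ℝ) < 1 := by
    intro s hs0 hs1
    have h0' : (0 : I) < s := Subtype.coe_lt_coe.1 (by simpa using hs0)
    have h1' : s < (1 : I) := Subtype.coe_lt_coe.1 (by simpa using hs1)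
    have h0'' := ρ.strictMono h0'
    have h1'' := ρ.strictMono h1'
    rw [hρ0] at h0''
    rw [hρ1] at h1''
    exact ⟨by simpa using (Subtype.coe_lt_coe.2 h0''), by simpa using (Subtype.coe_lt_coe.2 h1'')⟩
  have hmk : CurveClass.mk (c.reparam ρ) = CurveClass.mk c := CurveClass.mk_reparam c ρ
  refine ⟨?_, ?_, ?_, ?_, ?_, ?_, ?_, ?_, ?_⟩
  · rw [Curve.reparam_apply, hρ0, h.apply_zero]
  · rw [Curve.reparam_apply, hρ1, h.apply_one]
  · intro s hs0 hs1
    rw [Curve.reparam_apply]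
    exact h.mem_carrier _ (hρmem s hs0 hs1).1 (hρmem s hs0 hs1).2
  · intro s hs s' hs' heq
    rw [Curve.reparam_apply, Curve.reparam_apply] at heq
    exact ρ.injective (h.injOn (hρmem s hs.1 hs.2) (hρmem s' hs'.1 hs'.2) heq)
  · set g : ℝ → ℝ := fun u ↦ ((ρ (projIcc (0 : ℝ) 1 zero_le_one u) : I) : ℝ) with hg
    have hgmem : ∀ u, g u ∈ Icc (0 : ℝ) 1 := fun u ↦ (ρ (projIcc (0 : ℝ) 1 zero_le_one u)).2
    have heq : ∀ u, IccExtend zero_le_one (c.reparam ρ) u = IccExtend zero_le_one c (g u) := by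
      intro u
      rw [IccExtend_of_mem zero_le_one c (hgmem u)]
      rfl
    have hgc : Continuous g :=
      continuous_subtype_val.comp (ρ.toHomeomorph.continuous.comp continuous_projIcc)
    have hg1 : g 1 = 1 := by
      have hp1 : (projIcc (0 : ℝ) 1 zero_le_one 1 : I) = 1 :=
        Subtype.ext (by rw [coe_projIcc]; simp)
      simp only [hg]
      rw [hp1, hρ1]
      simp
    have hglt : ∀ u, u < 1 → g u < 1 := by
      intro u hu
      have hp : (projIcc (0 : ℝ) 1 zero_le_one u : I) < 1 := by
        refine Subtype.coe_lt_coe.1 ?_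
        rw [coe_projIcc]
        simp only [Icc.coe_one]
        exact max_lt (by norm_num) (min_lt_of_right_lt hu)
      have := ρ.strictMono hp
      rw [hρ1] at this
      simpa [hg] using (Subtype.coe_lt_coe.2 this)
    have hgt : Tendsto g (𝓝[<] 1) (𝓝[<] 1) := by
      refine tendsto_nhdsWithin_of_tendsto_nhds_of_eventually_within _ ?_ ?_
      · have := hgc.tendsto 1
        rw [hg1] at this
        exact this.mono_left nhdsWithin_le_nhds
      · filter_upwards [self_mem_nhdsWithin] with u hu using hglt u hu
    exact (h.tendsto_im.comp hgt).congr fun u ↦ by simp only [comp_apply, heq]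
  · intro n hn s t hst hs
    rw [Curve.reparam_apply] at hs ⊢
    exact h.transient n hn (ρ s) (ρ t) (ρ.monotone hst) hs
  · rw [hmk]; exact h.le_capacity
  · rw [hmk]; exact h.driving_modulus
  · rw [hmk]; exact h.tip_modulus

end IsRegularCurve

/-! ### A criterion for the capacity clause: Kemppainen–Smirnov's event `E₁` -/

/-- **Kemppainen–Smirnov's event `E₁` gives the capacity clause.** For a chordal uniformizing map
`φ` of `(D; a, b)`, a bound `β` and a capacity level `M` there is `d > 0` such that for every
simple chordal curve `c` of `(D; a, b)` whose Loewner transform satisfies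
`sup_{s ≤ M} |W s| ≤ β` (KS Prop. 3.8 (i): `P(sup_{[0, n]} |W| ≤ b_n) ≥ 1 - 1/n`), the
`Φ`-image of the trace point `γ̂(t)` is within `d` of `b` only when `t ≥ M`: indeed for `t < M`
the point `γ̂(t)` lies in the hull `K_t ⊆ B̄(W_0, sup_{s ≤ t}|W_s - W_0| + 4√t)` (Lawler's
Lemma 4.13, `Loewner.hull_subset_closedBall_driving`), inside the compact `Φ(B̄(0, |β| + 4√M) ∩ ℍ̄)`,
which avoids `b`. This is the form `IsRegularCurve.le_capacity` of the event.
[cite: KemppainenSmirnov2017, Prop. 3.8 (i) and §3.5] [cite: Lawler2005, Lemma 4.13] -/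
theorem MarkedDomain.IsChordalUniformizing.exists_capRad_of_driving_bound
    (hφ : D.IsChordalUniformizing φ) (β : ℝ) (M : ℝ≥0) :
    ∃ d : ℝ, 0 < d ∧ ∀ c : Curve ℂ, c 0 = D.pt 0 → c 1 = D.pt 1 →
      (∀ s : I, 0 < (s : ℝ) → (s : ℝ) < 1 → c s ∈ D.carrier) →
      InjOn c {s : I | 0 < (s : ℝ) ∧ (s : ℝ) < 1} →
      Tendsto (fun u : ℝ ↦ (φ.symm (IccExtend zero_le_one c u)).im) (𝓝[<] 1) atTop →
      (∀ s : ℝ≥0, s ≤ M → |drivingFunction φ (CurveClass.mk c) s| ≤ β) →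
      ∀ t : ℝ≥0, dist (φ.boundaryExtension
        (Loewner.trace (drivingFunction φ (CurveClass.mk c)) t)) (D.pt 1) < d → M ≤ t := by
  -- the compact set `K = Φ(B̄(0, R) ∩ ℍ̄)`, `R = |β| + 4 √M`, which avoids `b`
  set R : ℝ := |β| + 4 * Real.sqrt M with hR
  have hR0 : 0 ≤ R := by positivity
  set B : Set ℂ := closedBall (0 : ℂ) R ∩ {z : ℂ | 0 ≤ z.im} with hB
  have hBc : IsCompact B :=
    (isCompact_closedBall 0 R).inter_right (isClosed_le continuous_const Complex.continuous_im)
  have hcont : ContinuousOn φ.boundaryExtension {z : ℂ | 0 ≤ z.im} := by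
    rw [← ConformalEquiv.closure_upperHalfPlaneSet_eq]
    exact JordanDomain.continuousOn_boundaryExtension_holds D.toJordanDomain φ
  set K : Set ℂ := φ.boundaryExtension '' B with hK
  have hKc : IsCompact K := hBc.image_of_continuousOn (hcont.mono inter_subset_right)
  have h0B : (0 : ℂ) ∈ B := ⟨mem_closedBall_self hR0, by simp⟩
  have hKne : K.Nonempty := ⟨_, ⟨0, h0B, rfl⟩⟩
  have hbK : D.pt 1 ∉ K := by
    rintro ⟨z, ⟨-, hz⟩, hzb⟩
    exact MarkedDomain.boundaryExtension_ne_pt_one JordanDomain.exists_continuousOn_extension_holds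
      hφ hz hzb
  set d : ℝ := infDist (D.pt 1) K with hd
  have hd0 : 0 < d := (hKc.isClosed.notMem_iff_infDist_pos hKne).1 hbK
  refine ⟨d, hd0, fun c h0 h1 hin hinj hinf hβ t ht ↦ ?_⟩
  by_contra hlt
  push Not at hlt
  -- it suffices that the trace point lies in `B`
  suffices hmem : Loewner.trace (drivingFunction φ (CurveClass.mk c)) t ∈ B by
    have h1 : d ≤ dist (D.pt 1) (φ.boundaryExtension
        (Loewner.trace (drivingFunction φ (CurveClass.mk c)) t)) :=
      infDist_le_dist_of_mem ⟨_, hmem, rfl⟩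
    rw [dist_comm] at ht
    linarith
  obtain ⟨W, θ, hdesc, hW0, hθc, hθm, hθ0, hθinf, htr⟩ :=
    hφ.exists_isLoewnerDescribed_of_injOn h0 h1 hin hinj hinf
  have hWeq : drivingFunction φ (CurveClass.mk c) = W :=
    hdesc.drivingFunction_eq IsLoewnerDescribed.driving_unique_holds hφ
  rw [hWeq]
  rw [hWeq] at hβ
  rcases eq_or_ne t 0 with rfl | ht0
  · rw [Loewner.trace_zero, hW0, Complex.ofReal_zero]
    exact h0B
  -- `t = θ u` for some `u ∈ (0, 1)`
  obtain ⟨u, hu, hut⟩ : ∃ u ∈ Ioo (0 : ℝ) 1, θ u = t := by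
    have hev : ∀ᶠ v in 𝓝[<] (1 : ℝ), t ≤ θ v := hθinf.eventually (eventually_ge_atTop t)
    obtain ⟨v, hv, hvI⟩ := (hev.and (Ioo_mem_nhdsLT one_pos)).exists
    have hsub : Icc (0 : ℝ) v ⊆ Ico 0 1 := fun w hw ↦ ⟨hw.1, hw.2.trans_lt hvI.2⟩
    have hivt := intermediate_value_Icc hvI.1.le (hθc.mono hsub)
    rw [hθ0] at hivt
    obtain ⟨w, hw, hwt⟩ := hivt ⟨bot_le, hv⟩
    have hw0 : w ≠ 0 := by
      rintro rfl
      rw [hθ0] at hwt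
      exact ht0 hwt.symm
    exact ⟨w, ⟨hw.1.lt_of_ne' hw0, hw.2.trans_lt hvI.2⟩, hwt⟩
  subst hut
  have htru : Loewner.trace W (θ u) = φ.symm (c ⟨u, hu.1.le, hu.2.le⟩) := htr u hu
  have hpos : 0 < (Loewner.trace W (θ u)).im := by
    rw [htru]
    exact φ.symm_mapsTo (hin _ hu.1 hu.2)
  have hgen : Loewner.IsGeneratedByCurve W (Loewner.trace W) := by
    obtain ⟨-, γ, hγ, -⟩ := hdesc
    exact Loewner.isGeneratedByCurve_trace ⟨γ, hγ⟩
  have hmemhull : Loewner.trace W (θ u) ∈ Loewner.hull W (θ u) := by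
    rw [hgen.hull_eq]
    exact ⟨hpos, fun hU ↦ (Loewner.unboundedComponent_subset _ hU).2
      ⟨θ u, ⟨bot_le, le_rfl⟩, rfl⟩⟩
  have hS : ∀ s : ℝ≥0, s ≤ θ u → |W s - W 0| ≤ |β| := by
    intro s hs
    rw [hW0, sub_zero]
    exact (hβ s (hs.trans hlt.le)).trans (le_abs_self β)
  have hball := Loewner.hull_subset_closedBall_driving hdesc.continuous hS hmemhull
  rw [hW0, Complex.ofReal_zero, mem_closedBall] at hball
  refine ⟨mem_closedBall.2 (hball.trans ?_), hpos.le⟩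
  have : Real.sqrt (θ u) ≤ Real.sqrt M := Real.sqrt_le_sqrt (NNReal.coe_le_coe.2 hlt.le)
  linarith

/-! ### Limits of regular curves are Loewner curves driven by the limits of the driving terms -/

/-- **Kemppainen–Smirnov §3.5 with Lemmas A.5 and A.7: along a convergent sequence of regular
curves the limit class is described by the Loewner evolution and the Loewner transforms
converge.** Let `φ` be a chordal uniformizing map of `(D; a, b)`, `x_n ∈ regularCurves φ 𝔯` and
`x_n → x` in the space of curve classes. Then `x` is describable through `φ`
(`IsLoewnerDescribable φ x`) and `drivingFunction φ x_n → drivingFunction φ x` locally uniformly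
on `[0, ∞)`. Printed argument: reparametrise the approximants to converge uniformly to a light
representative of `x` (`Curve.exists_light_of_ne`, `exists_reparam_tendstoUniformly`); by the
transience clause the limit reaches `b` only at its end; the driving terms are equicontinuous
with `W_n(0) = 0`, so every subsequence has a locally uniformly convergent subsequence (Lemma
A.7 (a), `exists_subseq_tendstoLocallyUniformly_of_equicontinuous`); along it the main lemma
(`exists_isLoewnerDescribed_of_limit_of_tipModulus`) describes `x` by the limit `W`, which is
therefore the driving function of `x` (uniqueness, `IsLoewnerDescribed.driving_unique_holds`);
hence the whole sequence converges. [cite: KemppainenSmirnov2017, §3.5 and App. A Lemmas A.5, A.7]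
[cite: CDHKSCRAS2014, Thm. 3] -/
theorem tendstoLocallyUniformly_drivingFunction_of_mem_regularCurves
    (hφ : D.IsChordalUniformizing φ) {xn : ℕ → CurveClass ℂ} (hxn : ∀ n, xn n ∈ regularCurves φ 𝔯)
    {x : CurveClass ℂ} (hx : Tendsto xn atTop (𝓝 x)) :
    IsLoewnerDescribable φ x ∧
      TendstoLocallyUniformly (fun n ↦ drivingFunction φ (xn n)) (drivingFunction φ x) atTop := by
  choose γ hγx hreg using hxn
  have hab : D.pt 0 ≠ D.pt 1 := D.pt_injective.ne (by decide)
  /- endpoints of the limit class -/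
  have hsrc : x.source = D.pt 0 := by
    have h1 : Tendsto (fun n ↦ (xn n).source) atTop (𝓝 x.source) :=
      (CurveClass.continuous_source.tendsto x).comp hx
    have h2 : ∀ n, (xn n).source = D.pt 0 := fun n ↦ by
      rw [← hγx n, CurveClass.source_mk, Curve.source_def, (hreg n).apply_zero]
    simp only [h2] at h1
    exact (tendsto_const_nhds_iff.1 h1).symm
  have htgt : x.target = D.pt 1 := by
    have h1 : Tendsto (fun n ↦ (xn n).target) atTop (𝓝 x.target) :=
      (CurveClass.continuous_target.tendsto x).comp hx
    have h2 : ∀ n, (xn n).target = D.pt 1 := fun n ↦ by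
      rw [← hγx n, CurveClass.target_mk, Curve.target_def, (hreg n).apply_one]
    simp only [h2] at h1
    exact (tendsto_const_nhds_iff.1 h1).symm
  /- a light representative of the limit -/
  obtain ⟨c₁, hc₁⟩ := CurveClass.surjective_mk x
  have hc₁0 : c₁ 0 = D.pt 0 := by
    rw [← Curve.source_def, ← CurveClass.source_mk, hc₁, hsrc]
  have hc₁1 : c₁ 1 = D.pt 1 := by
    rw [← Curve.target_def, ← CurveClass.target_mk, hc₁, htgt]
  have h01 : c₁ 0 ≠ c₁ 1 := by rw [hc₁0, hc₁1]; exact hab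
  obtain ⟨c, hcc₁, hc0', hc1', hlight, -⟩ := Curve.exists_light_of_ne h01
  have hcx : CurveClass.mk c = x := hcc₁.trans hc₁
  have hc0 : c 0 = D.pt 0 := hc0'.trans hc₁0
  have hc1 : c 1 = D.pt 1 := hc1'.trans hc₁1
  /- uniformly convergent reparametrised representatives -/
  have hlim_mk : Tendsto (fun n ↦ CurveClass.mk (γ n)) atTop (𝓝 (CurveClass.mk c)) := by
    rw [hcx]
    simp only [hγx]
    exact hx
  obtain ⟨ρ, hρ⟩ := MarkedDomain.IsChordalUniformizing.exists_reparam_tendstoUniformly hlim_mk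
  set γ' : ℕ → Curve ℂ := fun n ↦ (γ n).reparam (ρ n) with hγ'
  have hreg' : ∀ n, IsRegularCurve φ 𝔯 (γ' n) := fun n ↦ (hreg n).reparam (ρ n)
  have hmk' : ∀ n, CurveClass.mk (γ' n) = xn n := fun n ↦
    (CurveClass.mk_reparam (γ n) (ρ n)).trans (hγx n)
  have hlimU : TendstoUniformly (fun n (s : I) ↦ γ' n s) c atTop := hρ
  set Wn : ℕ → ℝ≥0 → ℝ := fun n ↦ drivingFunction φ (xn n) with hWn
  have hWn' : ∀ n, drivingFunction φ (CurveClass.mk (γ' n)) = Wn n := fun n ↦ by rw [hmk' n]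
  /- the limit representative: in `closure D`, reaching `b` only at the end -/
  have hccl : ∀ s : I, c s ∈ closure D.carrier := fun s ↦
    isClosed_closure.mem_of_tendsto (hlimU.tendsto_at s)
      (Eventually.of_forall fun n ↦ (hreg' n).mem_closure s)
  have htrans : ∀ s t : I, s ≤ t → c s = D.pt 1 → c t = D.pt 1 := by
    intro s t hst hsb
    have hds : Tendsto (fun n ↦ dist (γ' n s) (D.pt 1)) atTop (𝓝 0) := by
      have h := (hlimU.tendsto_at s).dist (tendsto_const_nhds (x := D.pt 1))
      rwa [hsb, dist_self] at h
    have hdt : Tendsto (fun n ↦ dist (γ' n t) (D.pt 1)) atTop (𝓝 (dist (c t) (D.pt 1))) :=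
      (hlimU.tendsto_at t).dist tendsto_const_nhds
    -- for every `m > N`, eventually `|γ'_n s - b| ≤ ρ_m`, hence `|γ'_n t - b| < ρ_{m-1}`
    have hle : ∀ m : ℕ, 𝔯.transIdx < m → dist (c t) (D.pt 1) ≤ 𝔯.transSeq (m - 1) := by
      intro m hm
      have hev : ∀ᶠ n in atTop, dist (γ' n s) (D.pt 1) < 𝔯.transSeq m :=
        hds (Iio_mem_nhds (𝔯.transSeq_pos m))
      have hbound : ∀ᶠ n in atTop, dist (γ' n t) (D.pt 1) ≤ 𝔯.transSeq (m - 1) :=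
        hev.mono fun n hn ↦ ((hreg' n).transient m hm s t hst hn.le).le
      exact le_of_tendsto hdt hbound
    have hlim0 : Tendsto (fun m : ℕ ↦ 𝔯.transSeq (m - 1)) atTop (𝓝 0) :=
      𝔯.tendsto_transSeq.comp (tendsto_sub_atTop_nat 1)
    have hle0 : dist (c t) (D.pt 1) ≤ 0 :=
      ge_of_tendsto hlim0 (Filter.eventually_atTop.2 ⟨𝔯.transIdx + 1, fun m hm ↦ hle m hm⟩)
    exact dist_le_zero.1 hle0
  have hcb : ∀ s : I, (s : ℝ) < 1 → c s ≠ D.pt 1 := by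
    intro s hs hsb
    have hs1 : s < 1 := Subtype.coe_lt_coe.1 (by simpa using hs)
    obtain ⟨u, hsu, -, hne⟩ := hlight s 1 hs1
    exact hne ((htrans s u hsu hsb).trans hsb.symm)
  have hcl : ∀ s : I, (s : ℝ) < 1 → c s ∈ closure D.carrier ∧ c s ≠ D.pt 1 := fun s hs ↦
    ⟨hccl s, hcb s hs⟩
  /- the tip modulus and the capacity schedule, uniformly in `n` -/
  have htip : ∀ ρ' : ℝ, 0 < ρ' → ∃ δ : ℝ, 0 < δ ∧ ∃ ψ : ℝ → ℝ, Tendsto ψ (𝓝[>] 0) (𝓝 0) ∧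
      ∀ n, ∀ t : ℝ≥0,
        (∀ t' ≤ t, ρ' ≤ dist (φ.boundaryExtension (Loewner.trace (Wn n) t')) (D.pt 1)) →
        ∀ y ∈ Ioc (0 : ℝ) δ,
          ‖Loewner.loewnerInv (Wn n) t ((Wn n t : ℂ) + y * Complex.I) - Loewner.trace (Wn n) t‖ ≤
            ψ y := by
    intro ρ' hρ'
    obtain ⟨k, hk⟩ := 𝔯.exists_tipRad_lt ρ' hρ'
    refine ⟨𝔯.tipDepth k, 𝔯.tipDepth_pos k, 𝔯.tipMod k, 𝔯.tendsto_tipMod k, fun n t ht ↦ ?_⟩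
    have h := (hreg' n).tip_modulus k t
    rw [hWn' n] at h
    exact h fun t' ht' ↦ hk.le.trans (ht t' ht')
  have hcapd : ∀ M : ℝ, ∃ r : ℝ, 0 < r ∧ ∀ n, ∀ t : ℝ≥0,
      dist (φ.boundaryExtension (Loewner.trace (Wn n) t)) (D.pt 1) < r → M ≤ t := by
    intro M
    refine ⟨𝔯.capRad ⌈max M 0⌉₊, 𝔯.capRad_pos _, fun n t ht ↦ ?_⟩
    have h := (hreg' n).le_capacity ⌈max M 0⌉₊ t
    rw [hWn' n] at h
    calc M ≤ max M 0 := le_max_left _ _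
      _ ≤ ⌈max M 0⌉₊ := Nat.le_ceil _
      _ ≤ t := h ht
  /- equicontinuity of the driving terms, `W_n(0) = 0` -/
  have hW0 : ∀ n, Wn n 0 = 0 := fun n ↦ by
    rw [← hWn' n]
    exact (hreg' n).drivingFunction_zero hφ
  have hWc : ∀ n, Continuous (Wn n) := fun n ↦ continuous_drivingFunction φ _
  have heq : ∀ T : ℝ≥0, ∀ ε > 0, ∃ δ > 0, ∀ n, ∀ s t : ℝ≥0, s ≤ T → t ≤ T →
      dist s t < δ → dist (Wn n s) (Wn n t) < ε := by
    intro T ε hε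
    set T' : ℕ := ⌈(T : ℝ)⌉₊ with hT'
    have hTT' : T ≤ (T' : ℝ≥0) := by
      rw [← NNReal.coe_le_coe]
      push_cast
      exact Nat.le_ceil _
    have hev : ∀ᶠ h in 𝓝[>] (0 : ℝ), 𝔯.drvMod T' h < ε := (𝔯.tendsto_drvMod T') (Iio_mem_nhds hε)
    rw [eventually_nhdsWithin_iff, Metric.eventually_nhds_iff] at hev
    obtain ⟨δ, hδ, hδε⟩ := hev
    refine ⟨δ, hδ, fun n s t hs ht hst ↦ ?_⟩
    rcases eq_or_ne s t with rfl | hne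
    · simp [hε]
    have hpos : 0 < dist s t := dist_pos.2 hne
    have h1 : 𝔯.drvMod T' (dist s t) < ε := by
      refine hδε ?_ hpos
      rwa [Real.dist_0_eq_abs, abs_of_pos hpos]
    have h2 := (hreg' n).driving_modulus T' s t (hs.trans hTT') (ht.trans hTT')
    rw [hWn' n] at h2
    exact h2.trans_lt h1
  /- along every subsequence a further subsequence of the transforms converges to the driving
  function of `x`, which is describable -/
  have key : ∀ ns : ℕ → ℕ, StrictMono ns → ∃ ms : ℕ → ℕ, StrictMono ms ∧
      IsLoewnerDescribable φ x ∧
      TendstoLocallyUniformly (fun k ↦ Wn (ns (ms k))) (drivingFunction φ x) atTop := by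
    intro ns hns
    obtain ⟨ms, hms, W, hWcW, -, hconv⟩ := exists_subseq_tendstoLocallyUniformly_of_equicontinuous
      (Wn := fun k ↦ Wn (ns k)) (fun k ↦ hWc _) (fun k ↦ hW0 _)
      (fun T ε hε ↦ by
        obtain ⟨δ, hδ, h⟩ := heq T ε hε
        exact ⟨δ, hδ, fun k ↦ h _⟩)
    set sq : ℕ → ℕ := fun k ↦ ns (ms k) with hsq
    have hsqm : StrictMono sq := hns.comp hms
    have hsqt : Tendsto sq atTop atTop := hsqm.tendsto_atTop
    have hlimsq : TendstoUniformly (fun k (s : I) ↦ γ' (sq k) s) c atTop := fun u hu ↦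
      hsqt.eventually (hlimU u hu)
    have hfun : (fun k ↦ drivingFunction φ (CurveClass.mk (γ' (sq k)))) = fun k ↦ Wn (sq k) :=
      funext fun k ↦ hWn' (sq k)
    have hWlimsq : TendstoLocallyUniformly (fun k ↦ drivingFunction φ (CurveClass.mk (γ' (sq k)))) W
        atTop := by
      rw [hfun]
      exact hconv
    obtain ⟨hdesc, -, -⟩ := hφ.exists_isLoewnerDescribed_of_limit_of_tipModulus
      (cn := fun k ↦ γ' (sq k)) (c := c) (W := W)
      (fun k ↦ (hreg' _).apply_zero) (fun k ↦ (hreg' _).apply_one) (fun k ↦ (hreg' _).mem_carrier)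
      (fun k ↦ (hreg' _).injOn) (fun k ↦ (hreg' _).tendsto_im) hc0 hc1 hcl hlimsq hlight
      (fun ρ' hρ' ↦ by
        obtain ⟨δ, hδ, ψ, hψ, h⟩ := htip ρ' hρ'
        refine ⟨δ, hδ, ψ, hψ, Eventually.of_forall fun k ↦ ?_⟩
        rw [hWn' (sq k)]
        exact h (sq k))
      (fun M ↦ by
        obtain ⟨r, hr, h⟩ := hcapd M
        refine ⟨r, hr, Eventually.of_forall fun k ↦ ?_⟩
        rw [hWn' (sq k)]
        exact h (sq k))
      hWcW hWlimsq
    rw [hcx] at hdesc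
    have hWx : drivingFunction φ x = W :=
      hdesc.drivingFunction_eq IsLoewnerDescribed.driving_unique_holds hφ
    refine ⟨ms, hms, hdesc.isLoewnerDescribable, ?_⟩
    rw [hWx]
    exact hconv
  obtain ⟨-, -, hdescx, -⟩ := key id strictMono_id
  refine ⟨hdescx, ?_⟩
  /- the whole sequence converges: subsequence principle on compact time sets -/
  rw [← tendstoLocallyUniformlyOn_univ, tendstoLocallyUniformlyOn_iff_forall_isCompact isOpen_univ]
  intro K _ hK
  rw [Metric.tendstoUniformlyOn_iff]
  intro ε hε
  by_contra hcon
  have hfr : ∃ᶠ n in atTop, ∃ t ∈ K, ε ≤ dist (drivingFunction φ x t) (Wn n t) := by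
    rw [not_eventually] at hcon
    refine hcon.mono fun n hn ↦ ?_
    push Not at hn
    exact hn
  obtain ⟨ns, hns, hbad⟩ := extraction_of_frequently_atTop hfr
  obtain ⟨ms, -, -, hconv⟩ := key ns hns
  have hunifK : TendstoUniformlyOn (fun k ↦ Wn (ns (ms k))) (drivingFunction φ x) atTop K :=
    (tendstoLocallyUniformlyOn_iff_tendstoUniformlyOn_of_compact hK).1
      ((tendstoLocallyUniformlyOn_univ.2 hconv).mono (subset_univ K))
  obtain ⟨k, hk⟩ := ((Metric.tendstoUniformlyOn_iff.1 hunifK) ε hε).exists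
  obtain ⟨t, htK, hge⟩ := hbad (ms k)
  exact absurd (hk t htK) (not_lt.2 hge)

/-- **Every class in the closure of the regular curves is described by the Loewner evolution**
(KS Thm. 1.5 (ii) on the event: "the limiting curve is a Loewner curve").
[cite: KemppainenSmirnov2017, §3.5 and App. A Lemma A.5] -/
theorem isLoewnerDescribable_of_mem_closure_regularCurves (hφ : D.IsChordalUniformizing φ)
    {x : CurveClass ℂ} (hx : x ∈ closure (regularCurves φ 𝔯)) : IsLoewnerDescribable φ x := by
  obtain ⟨xn, hxn, hlim⟩ := mem_closure_iff_seq_limit.1 hx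
  exact (tendstoLocallyUniformly_drivingFunction_of_mem_regularCurves hφ hxn hlim).1

/-- **The driving path is continuous on the closure of the regular curves** (for the topology of
locally uniform convergence on `C([0, ∞), ℝ)`): the continuity, on KS's closed event, of
`γ ↦ W(γ)` that turns "`γ_n → γ`" into "`W_n → W`" (KS Thm. 1.5 (iii), Cor. 1.7). Diagonal
argument over `tendstoLocallyUniformly_drivingFunction_of_mem_regularCurves`.
[cite: KemppainenSmirnov2017, §3.5, Thm. 1.5 (iii) and Cor. 1.7] -/
theorem continuousOn_drivingPath_closure_regularCurves (hφ : D.IsChordalUniformizing φ)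
    (𝔯 : LoewnerRegularity) :
    ContinuousOn (fun c ↦ (⟨drivingFunction φ c, continuous_drivingFunction φ c⟩ : C(ℝ≥0, ℝ)))
      (closure (regularCurves φ 𝔯)) := by
  set S := regularCurves φ 𝔯 with hS
  intro x hx
  have hSne : S.Nonempty := by
    by_contra h
    rw [not_nonempty_iff_eq_empty] at h
    rw [h, closure_empty] at hx
    exact hx
  obtain ⟨s₀, hs₀⟩ := hSne
  -- approximation inside `S`, with close transforms on `[0, m]`
  have happrox : ∀ y ∈ closure S, ∀ m : ℕ, ∃ s ∈ S, dist s y < 1 / ((m : ℝ) + 1) ∧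
      ∀ t ∈ Icc (0 : ℝ≥0) m,
        dist (drivingFunction φ y t) (drivingFunction φ s t) < 1 / ((m : ℝ) + 1) := by
    intro y hy m
    obtain ⟨ys, hys, hylim⟩ := mem_closure_iff_seq_limit.1 hy
    have hconv := (tendstoLocallyUniformly_drivingFunction_of_mem_regularCurves hφ hys hylim).2
    have hunif : TendstoUniformlyOn (fun n ↦ drivingFunction φ (ys n)) (drivingFunction φ y) atTop
        (Icc 0 m) :=
      (tendstoLocallyUniformlyOn_iff_tendstoUniformlyOn_of_compact isCompact_Icc).1
        ((tendstoLocallyUniformlyOn_univ.2 hconv).mono (subset_univ _))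
    have hpos : (0 : ℝ) < 1 / ((m : ℝ) + 1) := by positivity
    have h1 : ∀ᶠ n in atTop, ∀ t ∈ Icc (0 : ℝ≥0) m,
        dist (drivingFunction φ y t) (drivingFunction φ (ys n) t) < 1 / ((m : ℝ) + 1) :=
      (Metric.tendstoUniformlyOn_iff.1 hunif) _ hpos
    have h2 : ∀ᶠ n in atTop, dist (ys n) y < 1 / ((m : ℝ) + 1) := Metric.tendsto_nhds.1 hylim _ hpos
    obtain ⟨n, hn1, hn2⟩ := (h1.and h2).exists
    exact ⟨ys n, hys n, hn2, hn1⟩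
  -- sequential criterion for the continuity within `closure S`
  refine (tendsto_iff_seq_tendsto (k := 𝓝[closure S] x)).2 fun xs hxs ↦ ?_
  rw [tendsto_nhdsWithin_iff] at hxs
  obtain ⟨hxs1, hxs2⟩ := hxs
  classical
  have hch : ∀ m : ℕ, ∃ s ∈ S, xs m ∈ closure S →
      (dist s (xs m) < 1 / ((m : ℝ) + 1) ∧ ∀ t ∈ Icc (0 : ℝ≥0) m,
        dist (drivingFunction φ (xs m) t) (drivingFunction φ s t) < 1 / ((m : ℝ) + 1)) := by
    intro m
    by_cases hm : xs m ∈ closure S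
    · obtain ⟨s, hs, h1, h2⟩ := happrox (xs m) hm m
      exact ⟨s, hs, fun _ ↦ ⟨h1, h2⟩⟩
    · exact ⟨s₀, hs₀, fun h ↦ absurd h hm⟩
  choose sm hsmS hsm using hch
  have hsmx : Tendsto sm atTop (𝓝 x) := by
    rw [Metric.tendsto_nhds]
    intro ε hε
    have h1 : ∀ᶠ m : ℕ in atTop, (1 : ℝ) / ((m : ℝ) + 1) < ε / 2 :=
      tendsto_one_div_add_atTop_nhds_zero_nat.eventually (Iio_mem_nhds (half_pos hε))
    have h2 : ∀ᶠ m in atTop, dist (xs m) x < ε / 2 := Metric.tendsto_nhds.1 hxs1 _ (half_pos hε)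
    filter_upwards [h1, h2, hxs2] with m hm1 hm2 hm3
    calc dist (sm m) x ≤ dist (sm m) (xs m) + dist (xs m) x := dist_triangle _ _ _
      _ < ε / 2 + ε / 2 := add_lt_add ((hsm m hm3).1.trans hm1) hm2
      _ = ε := by ring
  have hconv := (tendstoLocallyUniformly_drivingFunction_of_mem_regularCurves hφ hsmS hsmx).2
  rw [ContinuousMap.tendsto_iff_tendstoLocallyUniformly]
  change TendstoLocallyUniformly (fun n ↦ drivingFunction φ (xs n)) (drivingFunction φ x) atTop
  rw [← tendstoLocallyUniformlyOn_univ, tendstoLocallyUniformlyOn_iff_forall_isCompact isOpen_univ]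
  intro K _ hK
  obtain ⟨T, hT⟩ := hK.isBounded.bddAbove
  rw [Metric.tendstoUniformlyOn_iff]
  intro ε hε
  have hunifK : TendstoUniformlyOn (fun n ↦ drivingFunction φ (sm n)) (drivingFunction φ x) atTop K :=
    (tendstoLocallyUniformlyOn_iff_tendstoUniformlyOn_of_compact hK).1
      ((tendstoLocallyUniformlyOn_univ.2 hconv).mono (subset_univ _))
  have h1 := (Metric.tendstoUniformlyOn_iff.1 hunifK) (ε / 2) (half_pos hε)
  have h2 : ∀ᶠ m : ℕ in atTop, (1 : ℝ) / ((m : ℝ) + 1) < ε / 2 :=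
    tendsto_one_div_add_atTop_nhds_zero_nat.eventually (Iio_mem_nhds (half_pos hε))
  have h3 : ∀ᶠ m : ℕ in atTop, T ≤ (m : ℝ≥0) := by
    obtain ⟨N, hN⟩ := exists_nat_ge (T : ℝ)
    filter_upwards [eventually_ge_atTop N] with m hm
    rw [← NNReal.coe_le_coe]
    push_cast
    exact hN.trans (by exact_mod_cast hm)
  filter_upwards [h1, h2, h3, hxs2] with m hm1 hm2 hm3 hm4 t htK
  have htm : t ∈ Icc (0 : ℝ≥0) m := ⟨bot_le, (hT htK).trans hm3⟩
  calc dist (drivingFunction φ x t) (drivingFunction φ (xs m) t)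
      ≤ dist (drivingFunction φ x t) (drivingFunction φ (sm m) t) +
          dist (drivingFunction φ (sm m) t) (drivingFunction φ (xs m) t) := dist_triangle _ _ _
    _ < ε / 2 + ε / 2 := by
        refine add_lt_add (hm1 t htK) ?_
        rw [dist_comm]
        exact ((hsm m hm4).2 t htm).trans hm2
    _ = ε := by ring

/-! ### Plugging into the weak-limit transfer: Kemppainen–Smirnov's Theorem 1.5 from the mass of the events -/

/-- **Kemppainen–Smirnov's Thm. 1.5 (ii)–(iii) (with Cor. 1.7) from the mass of the regular
curves.** Let `φ` be a chordal uniformizing map of `(D; a, b)` and let the curve laws `μₙ`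
converge weakly to `ν`. If for every `ε > 0` there are regularity parameters `𝔯` with
`μₙ (regularCurves φ 𝔯)ᶜ ≤ ε` for ALL `n` (KS Prop. 3.2 / Thms. 3.9, 3.10: under Condition G2
the four random variables are tight, uniformly over the family), then `ν`-a.e. curve class is
described by the Loewner evolution through `φ`, and the driving processes
`W(γ_n) → W(γ)` converge in distribution (locally uniform topology) — the clauses (J′) consumed
by `LatticeModels/FKIsingCylinderIdentityAssembly.lean` and `InterfaceSLELimitData.lean`.
PROVED, by `ae_isLoewnerDescribable_and_tendstoInDistribution_drivingPath`
(`DrivingProcessWeakLimit.lean`) on the closed sets `closure (regularCurves φ 𝔯)`.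
[cite: KemppainenSmirnov2017, Thm. 1.5, Cor. 1.7, Prop. 3.2 and §3.5] [cite: CDHKSCRAS2014, Thm. 3] -/
theorem ae_isLoewnerDescribable_and_tendstoInDistribution_of_regularCurves
    (hφ : D.IsChordalUniformizing φ) {μs : ℕ → Measure (CurveClass ℂ)}
    [∀ n, IsProbabilityMeasure (μs n)] {ν : Measure (CurveClass ℂ)} [IsProbabilityMeasure ν]
    (hlim : ∀ f : CurveClass ℂ →ᵇ ℝ, Tendsto (fun n ↦ ∫ c, f c ∂μs n) atTop (𝓝 (∫ c, f c ∂ν)))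
    (h : ∀ ε : ℝ≥0∞, 0 < ε → ∃ 𝔯 : LoewnerRegularity, ∀ n, μs n (regularCurves φ 𝔯)ᶜ ≤ ε) :
    (∀ᵐ c ∂ν, IsLoewnerDescribable φ c) ∧
      TendstoInDistribution
        (fun (_ : ℕ) (c : CurveClass ℂ) ↦
          (⟨fun u ↦ drivingFunction φ c u, continuous_drivingFunction φ c⟩ : C(ℝ≥0, ℝ)))
        atTop (fun c ↦ (⟨drivingFunction φ c, continuous_drivingFunction φ c⟩ : C(ℝ≥0, ℝ))) μs ν := by
  refine ae_isLoewnerDescribable_and_tendstoInDistribution_drivingPath hφ hlim fun ε hε ↦ ?_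
  obtain ⟨𝔯, h𝔯⟩ := h ε hε
  refine ⟨closure (regularCurves φ 𝔯), isClosed_closure,
    fun c hc ↦ isLoewnerDescribable_of_mem_closure_regularCurves hφ hc,
    continuousOn_drivingPath_closure_regularCurves hφ 𝔯, fun n ↦ ?_⟩
  exact (measure_mono (compl_subset_compl.2 subset_closure)).trans (h𝔯 n)

end Literature.Probability.RandomPlanarGeometry
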